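import Literature.NumberTheory.Automorphic.UnitaryGroupSingularBracketCosetComparison
import Literature.NumberTheory.Automorphic.UnitaryGroupSubgroupCosetSumUnfolding
import Literature.NumberTheory.Automorphic.UnitaryGroupUnipotentHaarNormalisation
import Literature.NumberTheory.Automorphic.UnitaryGroupHeisenbergXLineLatticeUnfolding
import Literature.NumberTheory.Automorphic.UnitaryGroupBorelTorusUnipotentCoordinates
import Literature.NumberTheory.Automorphic.UnitaryGroupSingularBracketIntegrable
import Literature.NumberTheory.Automorphic.UnitaryGroupTruncatedKernelIntegrableCM
import Literature.NumberTheory.Automorphic.UnitaryGroupIwasawaAdelic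
import Literature.NumberTheory.Automorphic.UnitaryGroupKernelClassSingularSemisimple
import HarnessLib

/-!
# The singular Borel class of `U(J₃)`: `J^T_{i♭}(f) = ∫_X Σ'_{[γ₀]} + c_μ ∫_G β_{B_γ(F)}•b_T dν_G` (Rogawski's Prop. 7.2.1 ⇒ (7.2.3))
(Rogawski, *Automorphic Representations of Unitary Groups in Three Variables* (1990), §7.2 Prop. 7.2.1 and (7.2.2)–(7.2.3),
pp. 91–95; Arthur, *A trace formula for reductive groups I*, Duke Math. J. 45 (1978), §8.)

Topic `NumberTheory/Automorphic`; namespace `Literature.NumberTheory.Automorphic.UnitaryGroup`. THEOREMS ONLY (no definition,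
no named fact, no instance, no notation, no `sorry`). Row (b2-γ) of the T1-qs LAW 5 road of
`Cruxes/H413/Lines/F0_T1InnerFormTraceIdentity.lean` (cell `pub/hodgecm-mathlib`, crux H413), FILE B′2 = the `N(F)\N(𝔸_F)`-fibre
identity of the singular Borel defect and the ASSEMBLY, over ★ B′1 `UnitaryGroupSingularBracketCosetComparison` (letters there:
base point `γ₀ = ι(d(a,b,a))`, class `i♭`, A-p19's bracket `b_T` verbatim, centre integral `𝒯`, `u(x) = heisElt hc x 0`,
`n(w) = heisElt hc 0 w`, defect `𝓔(z) = K_{B,i♭}(z,z) − Σ'_{ξ∈E} 𝒯(u(ξ) z)`).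

* §7 `exists_torusInBorel_basePoint`; **`kernelBorelClass_singular_diag_eq_smul_integral_center_heis`** —
  `K_{B,i♭}(g, g) = μX(D_E)⁻¹ · ∫_{𝔸_E} 𝒯(u(x) g) dμX(x)` (★ (R1) `kernelBorelClass_singular_diag_eq_smul_integral`, Haar
  normalisation on `N(𝔸_F)` ★ `mul_inv_mul_integral_eq_integral_heisChart`, the singular twist with global Jacobian one ★
  `integral_prod_inv_mul_mul_mul_eq_of_principal`, Fubini ★ `integral_integral_singularKernel_swap` — the two covolume
  normalisations `ν(𝓕_N)⁻¹` and `μY(𝓕⁻)⁻¹` cancel exactly); `tsum_center_heis_mul_heisChart_mul`; and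
  **`setIntegral_singularDefect_unipotent_mul_eq_zero`** — THE `x`-FIBRE IDENTITY `∫_{Ω'} 𝓔(n g) dν(n) = 0` for every `g`, every
  Haar `ν` and every fundamental domain `Ω'` of `N(F)` (Mathlib `IsFundamentalDomain.setIntegral_eq` to the Heisenberg box, ★
  `exists_eq_smul_map_prod_heisChart`, and ★ F0P2-p02 `setIntegral_adeleFundamentalDomain_defect_eq_zero` on the `x`-line).
* §8 **`truncatedTraceClass_singular_eq_integral_add_mul_integral_singularBracket`** — for `T ≥ 1`, under the integrability of
  `[g] ↦ k^T_{i♭}(g⁻¹)` (★ LAW 3a), of `[g] ↦ Σ'_{s∈[γ₀]} f(g s g⁻¹)` (★ (b1)) and of the bracket against the covering weight `β`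
  of `B_{γ₀}(F)♯` (★ (b2-β) `lintegral_weight_mul_enorm_singularBracket_lt_top`):

    `J^T_{i♭}(f) = ∫_X Σ'_{s ∈ [γ₀]} f(x̃ s x̃⁻¹) dμ(x) + c_μ · ∫_{G(𝔸)} (β g) • b_T(g) dν_G(g)`,  `c_μ = unfoldingConstant G(F) count μ ν_G`

  — unfold the bracket at `Λ = B_γ(F)` (★ p07 `integrable_tsum_quotient_and_integral_eq_mul_integral_of_subgroup`), compare
  pointwise (★ B′1 `summable_and_tsum_singularBracket_quotient_eq`), get the descended defect series in `L¹(μ)` BY DIFFERENCE,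
  and kill its integral with ★ FILE A′ `integral_quotFun_pseudoEisenstein_indicator_eq_zero_of_fibre` + §7. The semisimple
  summand is left as the integral `∫_X Σ'_{[γ₀]}`; ★ (b1) `integral_conjTsum_conjOrbit_singular_eq_covol_mul_cm` evaluates it.

## References

* J. D. Rogawski, *Automorphic Representations of Unitary Groups in Three Variables*, Ann. of Math. Stud. 123 (1990), §7.2
  Prop. 7.2.1, (7.2.2)–(7.2.3) (pp. 91–95) [Rogawski1990].
* J. Arthur, *A trace formula for reductive groups I*, Duke Math. J. 45 (1978), §8 [Arthur1978TraceFormulaI].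
* S. Gelbart, *Automorphic forms on adele groups*, Ann. of Math. Stud. 83 (1975), §9.B [Gelbart1975].
-/

set_option autoImplicit false

noncomputable section

open MeasureTheory Measure NumberField IsDedekindDomain Set Polynomial Literature.MeasureTheory.Group
open scoped NNReal ENNReal Classical

namespace Literature.NumberTheory.Automorphic

namespace UnitaryGroup

variable {F E : Type} [Field F] [NumberField F] [Field E] [NumberField E] [Algebra F E]
  {c : E ≃ₐ[F] E}

/-- `(u z)⁻¹ X (u z) = z⁻¹ (u⁻¹ X u) z` (bookkeeping; private copy of B′1's). [folklore] -/
private theorem inv_mul_mul_mul_eq_conj_conj' (u X z : (quasiSplit F E c 3).Adelic) :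
    (u * z)⁻¹ * X * (u * z) = z⁻¹ * (u⁻¹ * X * u) * z := by
  group

/-! ## §7 The `x`-fibre identity: `K_{B,i♭}(g,g) = μX(D_E)⁻¹ ∫_{𝔸_E} 𝒯(u(x) g) dμX(x)` and `∫_{Ω'} 𝓔(n g) dν(n) = 0` -/

section FibreKernel

variable [MeasurableSpace (AdeleRing (𝓞 E) E)] [BorelSpace (AdeleRing (𝓞 E) E)]
  [MeasurableSpace (quasiSplit F E c 3).Adelic] [BorelSpace (quasiSplit F E c 3).Adelic]
  [MeasurableSpace (adelicUnipotent F E c 3)] [BorelSpace (adelicUnipotent F E c 3)]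

omit [MeasurableSpace (AdeleRing (𝓞 E) E)] [BorelSpace (AdeleRing (𝓞 E) E)]
  [MeasurableSpace (quasiSplit F E c 3).Adelic] [BorelSpace (quasiSplit F E c 3).Adelic]
  [MeasurableSpace (adelicUnipotent F E c 3)] [BorelSpace (adelicUnipotent F E c 3)] in
/-- **The base point as an adelic torus element with principal, distinct first two diagonal ideles** (`d₀ = a ⊗ 1`,
`d₁ = b ⊗ 1`, `a ≠ b`; ★ `coe_mem_torusAdelic_of_eq_diag`, ★ `diagUnit_mem_principalIdeles_of_mem_arithmeticSubgroup`).
[cite: Rogawski1990, §7.2 (p. 91)] -/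
theorem exists_torusInBorel_basePoint {a b : Eˣ} {g₀ : (quasiSplit F E c 3).Rational} {γ₀ : (quasiSplit F E c 3).arithmeticSubgroup}
    (hg₀ : ((g₀.val : GL (Fin 3) E) : Matrix (Fin 3) (Fin 3) E) = !![(a : E), 0, 0; 0, b, 0; 0, 0, a])
    (hγ₀ : (γ₀ : (quasiSplit F E c 3).Adelic) = (quasiSplit F E c 3).toAdelic g₀) (hab : (a : E) ≠ (b : E)) :
    ∃ t : torusInBorel F E c 3, ((t : borelAdelic F E c 3) : (quasiSplit F E c 3).Adelic) = (γ₀ : (quasiSplit F E c 3).Adelic) ∧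
      diagUnit (t : borelAdelic F E c 3).2 0 ∈ GaloisRepresentations.principalIdeles E ∧
      diagUnit (t : borelAdelic F E c 3).2 1 ∈ GaloisRepresentations.principalIdeles E ∧
      diagUnit (t : borelAdelic F E c 3).2 0 ≠ diagUnit (t : borelAdelic F E c 3).2 1 := by
  haveI : Nontrivial (AdeleRing (𝓞 E) E) :=
    inferInstanceAs (Nontrivial (InfiniteAdeleRing E × FiniteAdeleRing (𝓞 E) E))
  have hγ₀T : (γ₀ : (quasiSplit F E c 3).Adelic) ∈ torusAdelic F E c 3 := coe_mem_torusAdelic_of_eq_diag hg₀ hγ₀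
  refine ⟨⟨⟨(γ₀ : (quasiSplit F E c 3).Adelic), torusAdelic_le_borelAdelic hγ₀T⟩, (mem_torusInBorel_iff _).2 hγ₀T⟩, rfl,
    diagUnit_mem_principalIdeles_of_mem_arithmeticSubgroup _ γ₀.2 0,
    diagUnit_mem_principalIdeles_of_mem_arithmeticSubgroup _ γ₀.2 1, ?_⟩
  intro h
  have h' := congrArg (fun u : (AdeleRing (𝓞 E) E)ˣ => (u : AdeleRing (𝓞 E) E)) h
  simp only [coe_diagUnit] at h'
  change (adelicVal F E c 3 _ (γ₀ : (quasiSplit F E c 3).Adelic) : Matrix (Fin 3) (Fin 3) (AdeleRing (𝓞 E) E)) 0 0 =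
    (adelicVal F E c 3 _ (γ₀ : (quasiSplit F E c 3).Adelic) : Matrix (Fin 3) (Fin 3) (AdeleRing (𝓞 E) E)) 1 1 at h'
  rw [hγ₀] at h'
  change ((g₀.val : GL (Fin 3) E) : Matrix (Fin 3) (Fin 3) E).map (algebraMap E (AdeleRing (𝓞 E) E)) 0 0 =
    ((g₀.val : GL (Fin 3) E) : Matrix (Fin 3) (Fin 3) E).map (algebraMap E (AdeleRing (𝓞 E) E)) 1 1 at h'
  rw [Matrix.map_apply, Matrix.map_apply, hg₀] at h'
  simp only [Matrix.of_apply, Matrix.cons_val', Matrix.cons_val_zero, Matrix.cons_val_one,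
    Matrix.cons_val_fin_one] at h'
  exact hab ((algebraMap E (AdeleRing (𝓞 E) E)).injective h')

/-- **`K_{B,i♭}(g, g) = μX(D_E)⁻¹ · ∫_{𝔸_E} 𝒯(u(x) g) dμX(x)`** — the class Borel kernel of the singular class as the `x`-LINE
AVERAGE of the centre integral of the bracket: ★ (R1) `K_{B,i♭}(g,g) = ν(𝓕_N)⁻¹ ∫_{N(𝔸)} f(g⁻¹ γ₀ m g) dν(m)`, Haar
normalisation on `N(𝔸_F)` ★ `mul_inv_mul_integral_eq_integral_heisChart` (`ν(𝓕_N) ↔ μX(D_E)·μY(𝓕⁻)`), the singular twist with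
global Jacobian one ★ `integral_prod_inv_mul_mul_mul_eq_of_principal` (`γ₀ u(x,w) ↔ u(x)⁻¹ (γ₀ n(w)) u(x)`), and Fubini
(★ `integral_integral_singularKernel_swap`); the two covolume normalisations `ν(𝓕_N)⁻¹` and `μY(𝓕⁻)⁻¹` cancel exactly.
[cite: Rogawski1990, §7.2 (7.2.2)–(7.2.3) pp. 92–95] -/
theorem kernelBorelClass_singular_diag_eq_smul_integral_center_heis (hc : c * c = 1) {a b : Eˣ} {g₀ : (quasiSplit F E c 3).Rational} {γ₀ : (quasiSplit F E c 3).arithmeticSubgroup}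
    (hg₀ : ((g₀.val : GL (Fin 3) E) : Matrix (Fin 3) (Fin 3) E) = !![(a : E), 0, 0; 0, b, 0; 0, 0, a])
    (hγ₀ : (γ₀ : (quasiSplit F E c 3).Adelic) = (quasiSplit F E c 3).toAdelic g₀)
    (hab : (a : E) ≠ (b : E)) (ha : c (a : E) * (a : E) = 1) (hb : c (b : E) * (b : E) = 1)
    (ν : Measure (adelicUnipotent F E c 3)) [ν.IsHaarMeasure]
    {𝓕 : Set (adelicUnipotent F E c 3)} (h𝓕 : IsFundamentalDomain (rationalUnipotent F E c 3) 𝓕 ν)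
    (μX : Measure (AdeleRing (𝓞 E) E)) [μX.IsAddHaarMeasure] [μX.Regular] (μY : Measure (traceZeroAdele F E c)) [μY.IsAddHaarMeasure] [μY.Regular]
    {f : (quasiSplit F E c 3).Adelic → ℂ} (hfc : Continuous f) (hf : HasCompactSupport f) (g : (quasiSplit F E c 3).Adelic) :
    kernelBorelClass ν 𝓕 (fun γ : (quasiSplit F E c 3).arithmeticSubgroup => (((adelicVal F E c 3 _ (γ : (quasiSplit F E c 3).Adelic) :
          GL (Fin 3) (AdeleRing (𝓞 E) E)) : Matrix (Fin 3) (Fin 3) (AdeleRing (𝓞 E) E)).charpoly,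
        decide (∃ δ : (quasiSplit F E c 3).arithmeticSubgroup, δ * γ * δ⁻¹ ∈ arithmeticBorel F E c 3)))
      ((Polynomial.map (algebraMap E (AdeleRing (𝓞 E) E)) ((X - C (a : E)) ^ 2 * (X - C (b : E)))), true) f g g =
      (μX.real (adeleFundamentalDomain E))⁻¹ • ∫ x : AdeleRing (𝓞 E) E, (μY (traceZeroFundamentalDomain F E c)).toReal⁻¹ • ∫ w : traceZeroAdele F E c, f (((((heisElt hc (x) 0 : unipotentInBorel F E c 3) : borelAdelic F E c 3) : (quasiSplit F E c 3).Adelic) * g)⁻¹ * ((γ₀ : (quasiSplit F E c 3).Adelic) * (((heisElt hc 0 w : unipotentInBorel F E c 3) : borelAdelic F E c 3) : (quasiSplit F E c 3).Adelic)) * ((((heisElt hc (x) 0 : unipotentInBorel F E c 3) : borelAdelic F E c 3) : (quasiSplit F E c 3).Adelic) * g)) ∂μY ∂μX := by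
  haveI := locallyCompactSpace_adeleRing' E
  haveI := secondCountableTopology_adeleRing E
  haveI : T2Space (AdeleRing (𝓞 E) E) := t2Space_adeleRing_of_numberField E
  haveI : T2Space (quasiSplit F E c 3).Adelic :=
    inferInstanceAs (T2Space (adelic F E c 3 ((StdForm.antidiagonal 3).over E)))
  haveI : LocallyCompactSpace (quasiSplit F E c 3).Adelic :=
    inferInstanceAs (LocallyCompactSpace (adelic F E c 3 ((StdForm.antidiagonal 3).over E)))
  haveI := locallyCompactSpace_traceZeroAdele (F := F) (E := E) (c := c)
  haveI : SecondCountableTopology (traceZeroAdele F E c) := TopologicalSpace.Subtype.secondCountableTopology _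
  haveI : SigmaFinite μY := MeasureTheory.Measure.IsAddHaarMeasure.sigmaFinite μY
  haveI : SigmaFinite μX := MeasureTheory.Measure.IsAddHaarMeasure.sigmaFinite μX
  -- the base point as a torus element
  obtain ⟨t, ht, hd₀, hd₁, h₀₁⟩ := exists_torusInBorel_basePoint hg₀ hγ₀ hab
  have hd := glDiagonal_diagUnit_torus t
  -- (R1): `K_B(g,g) = ν(𝓕)⁻¹ • ∫_N f(g⁻¹ γ₀ m g) dν`
  rw [kernelBorelClass_singular_diag_eq_smul_integral hg₀ hγ₀ hab ha hb ν h𝓕 hfc hf g]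
  -- integrability of `m ↦ f(g⁻¹ γ₀ m g)` on `N(𝔸_F)`
  have hcl : IsClosed ((adelicUnipotent F E c 3 : Set (quasiSplit F E c 3).Adelic)) := by
    change IsClosed (⇑(adelicVal F E c 3 ((StdForm.antidiagonal 3).over E)) ⁻¹'
      ((upperUnitriangular (Fin 3) (AdeleRing (𝓞 E) E) : Subgroup (GL (Fin 3) (AdeleRing (𝓞 E) E))) :
        Set (GL (Fin 3) (AdeleRing (𝓞 E) E))))
    exact (isClosed_upperUnitriangular (R := AdeleRing (𝓞 E) E)).preimage continuous_subtype_val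
  have hemb : Topology.IsClosedEmbedding fun m : adelicUnipotent F E c 3 => (γ₀ : (quasiSplit F E c 3).Adelic) * (m : (quasiSplit F E c 3).Adelic) :=
    (Homeomorph.mulLeft (γ₀ : (quasiSplit F E c 3).Adelic)).isClosedEmbedding.comp (Topology.IsClosedEmbedding.subtypeVal hcl)
  have hgi : Integrable (fun m : adelicUnipotent F E c 3 => f (g⁻¹ * (γ₀ : (quasiSplit F E c 3).Adelic) * (m : (quasiSplit F E c 3).Adelic) * g)) ν := by
    have hcont : Continuous fun m : adelicUnipotent F E c 3 => f (g⁻¹ * (γ₀ : (quasiSplit F E c 3).Adelic) * (m : (quasiSplit F E c 3).Adelic) * g) :=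
      hfc.comp (((continuous_const.mul continuous_subtype_val)).mul continuous_const)
    have hsupp : HasCompactSupport fun m : adelicUnipotent F E c 3 => f (g⁻¹ * (γ₀ : (quasiSplit F E c 3).Adelic) * (m : (quasiSplit F E c 3).Adelic) * g) := by
      have h := (hasCompactSupport_conj hf g).comp_isClosedEmbedding hemb
      refine h.mono ?_   -- hmm
      intro m hm
      simpa only [Function.mem_support, ne_eq, Function.comp, mul_assoc] using hm
    exact hcont.integrable_of_hasCompactSupport hsupp
  -- Haar normalisation on `N(𝔸_F)` (★ p05): `(μX D_E · μY 𝓕⁻) · ν(𝓕)⁻¹ · ∫_N = ∫_x ∫_y' (· ∘ heisChart)`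
  have hp05 := mul_inv_mul_integral_eq_integral_heisChart hc μX μY ν h𝓕 hgi
  have hF1 : Integrable (fun p : AdeleRing (𝓞 E) E × traceZeroAdele F E c =>
      f (g⁻¹ * (γ₀ : (quasiSplit F E c 3).Adelic) * ((heisChart hc p : adelicUnipotent F E c 3) : (quasiSplit F E c 3).Adelic) * g)) (μX.prod μY) :=
    (integrable_comp_heisChart_prod_iff hc μX μY ν (fun m : adelicUnipotent F E c 3 => f (g⁻¹ * (γ₀ : (quasiSplit F E c 3).Adelic) * (m : (quasiSplit F E c 3).Adelic) * g))).2 hgi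
  have e1 : ∫ x, ∫ y', f (g⁻¹ * (γ₀ : (quasiSplit F E c 3).Adelic) * ((heisChart hc (x, y') : adelicUnipotent F E c 3) : (quasiSplit F E c 3).Adelic) * g) ∂μY ∂μX =
      ∫ p : AdeleRing (𝓞 E) E × traceZeroAdele F E c,
        f (g⁻¹ * (γ₀ : (quasiSplit F E c 3).Adelic) * ((heisChart hc p : adelicUnipotent F E c 3) : (quasiSplit F E c 3).Adelic) * g) ∂(μX.prod μY) :=
    (integral_prod _ hF1).symm
  -- the product integral is the `heisHaar`-integral of `n ↦ f(g⁻¹ (γ₀ n) g)`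
  have e2 : ∫ p : AdeleRing (𝓞 E) E × traceZeroAdele F E c,
        f (g⁻¹ * (γ₀ : (quasiSplit F E c 3).Adelic) * ((heisChart hc p : adelicUnipotent F E c 3) : (quasiSplit F E c 3).Adelic) * g) ∂(μX.prod μY) =
      ∫ n : unipotentInBorel F E c 3, f (g⁻¹ * ((((t : borelAdelic F E c 3) * (n : borelAdelic F E c 3) :
        borelAdelic F E c 3)) : (quasiSplit F E c 3).Adelic) * g) ∂(heisHaar hc μX μY) := by
    have hψc : Continuous fun n : unipotentInBorel F E c 3 => f (g⁻¹ * ((((t : borelAdelic F E c 3) * (n : borelAdelic F E c 3) :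
        borelAdelic F E c 3)) : (quasiSplit F E c 3).Adelic) * g) :=
      hfc.comp ((continuous_const.mul (continuous_subtype_val.comp (continuous_const.mul continuous_subtype_val))).mul
        continuous_const)
    rw [heisHaar, integral_map (heisHomeomorph hc).continuous.measurable.aemeasurable hψc.aestronglyMeasurable]
    refine integral_congr_ae (Filter.Eventually.of_forall fun p => ?_)
    simp only [heisHomeomorph_apply, Subgroup.coe_mul, coe_heisChart, ht, mul_assoc]
  -- the singular twist, global Jacobian one (★ p822820)
  have e3 := integral_prod_inv_mul_mul_mul_eq_of_principal hc μX μY t hd hd₀ hd₁ h₀₁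
    (fun bb : borelAdelic F E c 3 => f (g⁻¹ * (bb : (quasiSplit F E c 3).Adelic) * g))
  have hF2 := (integral_integral_singularKernel_swap hc hab hg₀ hγ₀ (hasCompactSupport_conj hf g) (continuous_conj hfc g) μX μY).1
  have e4 : ∫ p : AdeleRing (𝓞 E) E × traceZeroAdele F E c,
        (fun bb : borelAdelic F E c 3 => f (g⁻¹ * (bb : (quasiSplit F E c 3).Adelic) * g))
          (((heisElt hc p.1 (0 : traceZeroAdele F E c) : unipotentInBorel F E c 3) : borelAdelic F E c 3)⁻¹ *
            (t : borelAdelic F E c 3) *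
            ((heisElt hc 0 p.2 : unipotentInBorel F E c 3) : borelAdelic F E c 3) *
            ((heisElt hc p.1 (0 : traceZeroAdele F E c) : unipotentInBorel F E c 3) : borelAdelic F E c 3)) ∂(μX.prod μY) =
      ∫ x : AdeleRing (𝓞 E) E, ∫ w : traceZeroAdele F E c,
        f (g⁻¹ * (((((heisElt hc (x) 0 : unipotentInBorel F E c 3) : borelAdelic F E c 3) : (quasiSplit F E c 3).Adelic))⁻¹ * ((γ₀ : (quasiSplit F E c 3).Adelic) * (((heisElt hc 0 w : unipotentInBorel F E c 3) : borelAdelic F E c 3) : (quasiSplit F E c 3).Adelic)) * (((heisElt hc (x) 0 : unipotentInBorel F E c 3) : borelAdelic F E c 3) : (quasiSplit F E c 3).Adelic)) * g) ∂μY ∂μX := by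
    rw [← integral_prod _ hF2]
    refine integral_congr_ae (Filter.Eventually.of_forall fun p => ?_)
    simp only [Subgroup.coe_mul, Subgroup.coe_inv, ht, mul_assoc]
  -- the inner `w`-integral is `μY(𝓕⁻) • 𝒯(u(x) g)`
  obtain ⟨hne, hlt⟩ := measure_heisFundamentalDomain_pos_lt_top (F := F) hc μX μY
  have hX0 : (μX (adeleFundamentalDomain E)).toReal ≠ 0 := by
    refine ENNReal.toReal_ne_zero.2 ⟨(mul_ne_zero_iff.1 hne).1, ?_⟩
    exact (ENNReal.mul_lt_top_iff.1 hlt).elim (fun h => h.1.ne) (fun h => by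
      rcases h with h | h
      · exact absurd h (mul_ne_zero_iff.1 hne).1
      · exact absurd h (mul_ne_zero_iff.1 hne).2)
  have hY0 : (μY (traceZeroFundamentalDomain F E c)).toReal ≠ 0 := by
    refine ENNReal.toReal_ne_zero.2 ⟨(mul_ne_zero_iff.1 hne).2, ?_⟩
    exact (ENNReal.mul_lt_top_iff.1 hlt).elim (fun h => h.2.ne) (fun h => by
      rcases h with h | h
      · exact absurd h (mul_ne_zero_iff.1 hne).1
      · exact absurd h (mul_ne_zero_iff.1 hne).2)
  have e5 : ∀ x : AdeleRing (𝓞 E) E, ∫ w : traceZeroAdele F E c,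
        f (g⁻¹ * (((((heisElt hc (x) 0 : unipotentInBorel F E c 3) : borelAdelic F E c 3) : (quasiSplit F E c 3).Adelic))⁻¹ * ((γ₀ : (quasiSplit F E c 3).Adelic) * (((heisElt hc 0 w : unipotentInBorel F E c 3) : borelAdelic F E c 3) : (quasiSplit F E c 3).Adelic)) * (((heisElt hc (x) 0 : unipotentInBorel F E c 3) : borelAdelic F E c 3) : (quasiSplit F E c 3).Adelic)) * g) ∂μY =
      (μY (traceZeroFundamentalDomain F E c)).toReal • ((μY (traceZeroFundamentalDomain F E c)).toReal⁻¹ • ∫ w : traceZeroAdele F E c, f (((((heisElt hc (x) 0 : unipotentInBorel F E c 3) : borelAdelic F E c 3) : (quasiSplit F E c 3).Adelic) * g)⁻¹ * ((γ₀ : (quasiSplit F E c 3).Adelic) * (((heisElt hc 0 w : unipotentInBorel F E c 3) : borelAdelic F E c 3) : (quasiSplit F E c 3).Adelic)) * ((((heisElt hc (x) 0 : unipotentInBorel F E c 3) : borelAdelic F E c 3) : (quasiSplit F E c 3).Adelic) * g)) ∂μY) := by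
    intro x
    rw [smul_inv_smul₀ hY0]
    refine integral_congr_ae (Filter.Eventually.of_forall fun w => ?_)
    simp only [inv_mul_mul_mul_eq_conj_conj']
  -- assembly of the scalars
  have hνinv : ((μX (adeleFundamentalDomain E) * μY (traceZeroFundamentalDomain F E c)).toReal : ℂ) *
      ((ν 𝓕).toReal : ℂ)⁻¹ * ∫ m : adelicUnipotent F E c 3, f (g⁻¹ * (γ₀ : (quasiSplit F E c 3).Adelic) * (m : (quasiSplit F E c 3).Adelic) * g) ∂ν =
      ((μY (traceZeroFundamentalDomain F E c)).toReal : ℂ) *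
        ∫ x : AdeleRing (𝓞 E) E, (μY (traceZeroFundamentalDomain F E c)).toReal⁻¹ • ∫ w : traceZeroAdele F E c, f (((((heisElt hc (x) 0 : unipotentInBorel F E c 3) : borelAdelic F E c 3) : (quasiSplit F E c 3).Adelic) * g)⁻¹ * ((γ₀ : (quasiSplit F E c 3).Adelic) * (((heisElt hc 0 w : unipotentInBorel F E c 3) : borelAdelic F E c 3) : (quasiSplit F E c 3).Adelic)) * ((((heisElt hc (x) 0 : unipotentInBorel F E c 3) : borelAdelic F E c 3) : (quasiSplit F E c 3).Adelic) * g)) ∂μY ∂μX := by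
    rw [hp05, e1, e2, ← e3, e4]
    simp_rw [e5]
    rw [integral_smul, Complex.real_smul]
  rw [ENNReal.toReal_mul] at hνinv
  have hX0' : ((μX (adeleFundamentalDomain E)).toReal : ℂ) ≠ 0 := Complex.ofReal_ne_zero.2 hX0
  have hY0' : ((μY (traceZeroFundamentalDomain F E c)).toReal : ℂ) ≠ 0 := Complex.ofReal_ne_zero.2 hY0
  push_cast at hνinv
  rw [Complex.real_smul, Complex.real_smul, Measure.real, Complex.ofReal_inv, Complex.ofReal_inv]
  calc ((ν 𝓕).toReal : ℂ)⁻¹ * ∫ m : adelicUnipotent F E c 3, f (g⁻¹ * (γ₀ : (quasiSplit F E c 3).Adelic) * (m : (quasiSplit F E c 3).Adelic) * g) ∂ν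
      = ((μX (adeleFundamentalDomain E)).toReal : ℂ)⁻¹ * ((μY (traceZeroFundamentalDomain F E c)).toReal : ℂ)⁻¹ *
          (((μX (adeleFundamentalDomain E)).toReal : ℂ) * ((μY (traceZeroFundamentalDomain F E c)).toReal : ℂ) *
            ((ν 𝓕).toReal : ℂ)⁻¹ *
            ∫ m : adelicUnipotent F E c 3, f (g⁻¹ * (γ₀ : (quasiSplit F E c 3).Adelic) * (m : (quasiSplit F E c 3).Adelic) * g) ∂ν) := by
        field_simp
    _ = ((μX (adeleFundamentalDomain E)).toReal : ℂ)⁻¹ * ((μY (traceZeroFundamentalDomain F E c)).toReal : ℂ)⁻¹ *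
          (((μY (traceZeroFundamentalDomain F E c)).toReal : ℂ) *
            ∫ x : AdeleRing (𝓞 E) E, (μY (traceZeroFundamentalDomain F E c)).toReal⁻¹ • ∫ w : traceZeroAdele F E c,
              f (((((heisElt hc (x) 0 : unipotentInBorel F E c 3) : borelAdelic F E c 3) : (quasiSplit F E c 3).Adelic) * g)⁻¹ *
                ((γ₀ : (quasiSplit F E c 3).Adelic) * (((heisElt hc 0 w : unipotentInBorel F E c 3) : borelAdelic F E c 3) : (quasiSplit F E c 3).Adelic)) *
                ((((heisElt hc (x) 0 : unipotentInBorel F E c 3) : borelAdelic F E c 3) : (quasiSplit F E c 3).Adelic) * g)) ∂μY ∂μX) := by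
        rw [hνinv]
    _ = _ := by
        field_simp

end FibreKernel


section Fibre

variable [MeasurableSpace (AdeleRing (𝓞 E) E)] [BorelSpace (AdeleRing (𝓞 E) E)]
  [MeasurableSpace (quasiSplit F E c 3).Adelic] [BorelSpace (quasiSplit F E c 3).Adelic]
  [MeasurableSpace (adelicUnipotent F E c 3)] [BorelSpace (adelicUnipotent F E c 3)]

omit [BorelSpace (AdeleRing (𝓞 E) E)] [MeasurableSpace (quasiSplit F E c 3).Adelic] [BorelSpace (quasiSplit F E c 3).Adelic]
  [MeasurableSpace (adelicUnipotent F E c 3)] [BorelSpace (adelicUnipotent F E c 3)] in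
/-- **`Σ'_ξ 𝒯(u(ξ) · u(x, w) · g) = Σ'_ξ 𝒯(u(algebraMap ξ + x) · g)`**: `u(ξ) u(x,w) = u(ξ + x) n(·)` in the Heisenberg group (★
`heisX_mul`, ★ `heisElt_heisX_heisY`, ★ `coe_heisElt_eq_heisElt_zero_mul_center`) and the central factor is invisible (§1).
[cite: Rogawski1990, §7.2 (7.2.3) p. 93] -/
theorem tsum_center_heis_mul_heisChart_mul (hc : c * c = 1) {a b : Eˣ} {g₀ : (quasiSplit F E c 3).Rational} {γ₀ : (quasiSplit F E c 3).arithmeticSubgroup}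
    (hg₀ : ((g₀.val : GL (Fin 3) E) : Matrix (Fin 3) (Fin 3) E) = !![(a : E), 0, 0; 0, b, 0; 0, 0, a])
    (hγ₀ : (γ₀ : (quasiSplit F E c 3).Adelic) = (quasiSplit F E c 3).toAdelic g₀)
    (μY : Measure (traceZeroAdele F E c)) (f : (quasiSplit F E c 3).Adelic → ℂ) (x : AdeleRing (𝓞 E) E) (w₀ : traceZeroAdele F E c) (g : (quasiSplit F E c 3).Adelic) :
    ∑' ξ : E, (μY (traceZeroFundamentalDomain F E c)).toReal⁻¹ • ∫ w : traceZeroAdele F E c, f (((((heisElt hc (algebraMap E (AdeleRing (𝓞 E) E) ξ) 0 : unipotentInBorel F E c 3) : borelAdelic F E c 3) : (quasiSplit F E c 3).Adelic) * (((heisChart hc (x, w₀) : adelicUnipotent F E c 3) : (quasiSplit F E c 3).Adelic) * g))⁻¹ * ((γ₀ : (quasiSplit F E c 3).Adelic) * (((heisElt hc 0 w : unipotentInBorel F E c 3) : borelAdelic F E c 3) : (quasiSplit F E c 3).Adelic)) * ((((heisElt hc (algebraMap E (AdeleRing (𝓞 E) E) ξ) 0 : unipotentInBorel F E c 3) : borelAdelic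 F E c 3) : (quasiSplit F E c 3).Adelic) * (((heisChart hc (x, w₀) : adelicUnipotent F E c 3) : (quasiSplit F E c 3).Adelic) * g))) ∂μY =
      ∑' ξ : E, (μY (traceZeroFundamentalDomain F E c)).toReal⁻¹ • ∫ w : traceZeroAdele F E c, f (((((heisElt hc (algebraMap E (AdeleRing (𝓞 E) E) ξ + x) 0 : unipotentInBorel F E c 3) : borelAdelic F E c 3) : (quasiSplit F E c 3).Adelic) * g)⁻¹ * ((γ₀ : (quasiSplit F E c 3).Adelic) * (((heisElt hc 0 w : unipotentInBorel F E c 3) : borelAdelic F E c 3) : (quasiSplit F E c 3).Adelic)) * ((((heisElt hc (algebraMap E (AdeleRing (𝓞 E) E) ξ + x) 0 : unipotentInBorel F E c 3) : borelAdelic F E c 3) : (quasiSplit F E c 3).Adelic) * g)) ∂μY := by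
  have hcomm : ∀ w : traceZeroAdele F E c, (γ₀ : (quasiSplit F E c 3).Adelic) * (((heisElt hc 0 w : unipotentInBorel F E c 3) : borelAdelic F E c 3) : (quasiSplit F E c 3).Adelic) = (((heisElt hc 0 w : unipotentInBorel F E c 3) : borelAdelic F E c 3) : (quasiSplit F E c 3).Adelic) * (γ₀ : (quasiSplit F E c 3).Adelic) :=
    fun w => basePoint_mul_center_comm hc hg₀ hγ₀ w
  refine tsum_congr fun ξ => ?_
  -- `u(ξ) · u(x,w) = u(ξ + x) · n(Y)`
  set m : unipotentInBorel F E c 3 := heisElt hc (algebraMap E (AdeleRing (𝓞 E) E) ξ) 0 * heisElt hc x w₀ with hm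
  have hX : heisX m = algebraMap E (AdeleRing (𝓞 E) E) ξ + x := by
    rw [hm, heisX_mul, heisX_heisElt, heisX_heisElt]
  have hprod : (((heisElt hc (algebraMap E (AdeleRing (𝓞 E) E) ξ) 0 : unipotentInBorel F E c 3) : borelAdelic F E c 3) : (quasiSplit F E c 3).Adelic) * (((heisChart hc (x, w₀) : adelicUnipotent F E c 3) : (quasiSplit F E c 3).Adelic) * g) =
      (((heisElt hc (algebraMap E (AdeleRing (𝓞 E) E) ξ + x) 0 : unipotentInBorel F E c 3) : borelAdelic F E c 3) : (quasiSplit F E c 3).Adelic) * (((heisElt hc 0 (heisY hc m) : unipotentInBorel F E c 3) : borelAdelic F E c 3) : (quasiSplit F E c 3).Adelic) * g := by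
    rw [coe_heisChart, ← mul_assoc]
    change (((heisElt hc (algebraMap E (AdeleRing (𝓞 E) E) ξ) 0 : unipotentInBorel F E c 3) : borelAdelic F E c 3) : (quasiSplit F E c 3).Adelic) *
        (((heisElt hc x w₀ : unipotentInBorel F E c 3) : borelAdelic F E c 3) : (quasiSplit F E c 3).Adelic) * g = _
    rw [← Subgroup.coe_mul, ← Subgroup.coe_mul, ← hm, ← coe_heisElt_eq_heisElt_zero_mul_center hc, ← hX, heisElt_heisX_heisY]
  rw [hprod, integral_center_unipotent_center_mul hc hcomm μY f _ _ g]

/-- **THE `x`-FIBRE IDENTITY: `∫_{Ω'} 𝓔(n g) dν(n) = 0`** for EVERY `g ∈ G(𝔸_F)`, every Haar measure `ν` of `N(𝔸_F)` and every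
fundamental domain `Ω'` of `N(F)` — the singular Borel defect has vanishing `N(F)\\N(𝔸_F)`-fibres (no height condition). PROOF:
the integrand is `N(F)`-invariant, so `Ω'` may be replaced by the Heisenberg box `heisChart(D_E × 𝓕⁻)` (Mathlib
`IsFundamentalDomain.setIntegral_eq`); `ν = r · heisChart_*(μX ⊗ μY)` (★ `exists_eq_smul_map_prod_heisChart`); on the box
`𝓔(u(x,w) g) = μX(D_E)⁻¹ ∫ G − Σ'_{e ∈ E} G(e + x)` with `G(x) = 𝒯(u(x) g)` (`kernelBorelClass_singular_diag_eq_smul_integral_center_heis`,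
`tsum_center_heis_mul_heisChart_mul`), independent of `w`; and `∫_{D_E} (μX(D_E)⁻¹ ∫ G − Σ'_e G(e + x)) dμX = 0` is ★ F0P2-p02
`setIntegral_adeleFundamentalDomain_defect_eq_zero`. [cite: Rogawski1990, §7.2 (7.2.2)–(7.2.3) pp. 92–95] [cite: Arthur1978TraceFormulaI, §8] -/
theorem setIntegral_singularDefect_unipotent_mul_eq_zero (hc : c * c = 1) (hc1 : c ≠ 1) {a b : Eˣ} {g₀ : (quasiSplit F E c 3).Rational} {γ₀ : (quasiSplit F E c 3).arithmeticSubgroup}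
    (hg₀ : ((g₀.val : GL (Fin 3) E) : Matrix (Fin 3) (Fin 3) E) = !![(a : E), 0, 0; 0, b, 0; 0, 0, a])
    (hγ₀ : (γ₀ : (quasiSplit F E c 3).Adelic) = (quasiSplit F E c 3).toAdelic g₀)
    (hab : (a : E) ≠ (b : E)) (ha : c (a : E) * (a : E) = 1) (hb : c (b : E) * (b : E) = 1)
    (ν : Measure (adelicUnipotent F E c 3)) [ν.IsHaarMeasure]
    {𝓕 : Set (adelicUnipotent F E c 3)} (h𝓕 : IsFundamentalDomain (rationalUnipotent F E c 3) 𝓕 ν)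
    (μY : Measure (traceZeroAdele F E c)) [μY.IsAddHaarMeasure] [μY.Regular] {f : (quasiSplit F E c 3).Adelic → ℂ} (hfc : Continuous f) (hf : HasCompactSupport f)
    {Ω' : Set (adelicUnipotent F E c 3)} (hΩ' : IsFundamentalDomain (rationalUnipotent F E c 3) Ω' ν) (g : (quasiSplit F E c 3).Adelic) :
    ∫ n in Ω', (fun z : (quasiSplit F E c 3).Adelic => kernelBorelClass ν 𝓕 (fun γ : (quasiSplit F E c 3).arithmeticSubgroup => (((adelicVal F E c 3 _ (γ : (quasiSplit F E c 3).Adelic) :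
          GL (Fin 3) (AdeleRing (𝓞 E) E)) : Matrix (Fin 3) (Fin 3) (AdeleRing (𝓞 E) E)).charpoly,
        decide (∃ δ : (quasiSplit F E c 3).arithmeticSubgroup, δ * γ * δ⁻¹ ∈ arithmeticBorel F E c 3)))
      ((Polynomial.map (algebraMap E (AdeleRing (𝓞 E) E)) ((X - C (a : E)) ^ 2 * (X - C (b : E)))), true) f (z) (z) -
        ∑' ξ : E, (μY (traceZeroFundamentalDomain F E c)).toReal⁻¹ • ∫ w : traceZeroAdele F E c, f (((((heisElt hc (algebraMap E (AdeleRing (𝓞 E) E) ξ) 0 : unipotentInBorel F E c 3) : borelAdelic F E c 3) : (quasiSplit F E c 3).Adelic) * z)⁻¹ * ((γ₀ : (quasiSplit F E c 3).Adelic) * (((heisElt hc 0 w : unipotentInBorel F E c 3) : borelAdelic F E c 3) : (quasiSplit F E c 3).Adelic)) * ((((heisElt hc (algebraMap E (AdeleRing (𝓞 E) E) ξ) 0 : unipotentInBorel F E c 3) : borelAdelic F E c 3) : (quasiSplit F E c 3).Adelic) * z)) ∂μY) ((n : (quasiSplit F E c 3).Adelic) * g) ∂ν = 0 := by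
  classical
  -- plumbing
  haveI := locallyCompactSpace_adeleRing' E
  haveI := secondCountableTopology_adeleRing E
  haveI : T2Space (AdeleRing (𝓞 E) E) := t2Space_adeleRing_of_numberField E
  haveI : T2Space (quasiSplit F E c 3).Adelic := inferInstanceAs (T2Space (adelic F E c 3 ((StdForm.antidiagonal 3).over E)))
  haveI : LocallyCompactSpace (quasiSplit F E c 3).Adelic := inferInstanceAs (LocallyCompactSpace (adelic F E c 3 ((StdForm.antidiagonal 3).over E)))
  haveI : SecondCountableTopology (quasiSplit F E c 3).Adelic := inferInstanceAs (SecondCountableTopology (adelic F E c 3 ((StdForm.antidiagonal 3).over E)))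
  haveI := locallyCompactSpace_traceZeroAdele (F := F) (E := E) (c := c)
  haveI : SecondCountableTopology (traceZeroAdele F E c) := TopologicalSpace.Subtype.secondCountableTopology _
  haveI : SecondCountableTopology (adelicUnipotent F E c 3) := TopologicalSpace.Subtype.secondCountableTopology _
  haveI : SigmaFinite μY := MeasureTheory.Measure.IsAddHaarMeasure.sigmaFinite μY
  haveI : MeasurableConstSMul (rationalUnipotent F E c 3) (adelicUnipotent F E c 3) :=
    ⟨fun γ => (continuous_const.mul continuous_id).measurable⟩
  haveI : SMulInvariantMeasure (rationalUnipotent F E c 3) (adelicUnipotent F E c 3) ν :=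
    ⟨fun γ s _hs => by
      rw [show (fun u : adelicUnipotent F E c 3 => γ • u) ⁻¹' s =
          (fun u : adelicUnipotent F E c 3 => ((γ : adelicUnipotent F E c 3)) * u) ⁻¹' s from rfl,
        measure_preimage_mul]⟩
  haveI : Countable (rationalUnipotent F E c 3) := by
    haveI : Countable (quasiSplit F E c 3).arithmeticSubgroup := by
      haveI : Countable E := NumberField.countable' (K := E)
      haveI : Countable (Matrix (Fin 3) (Fin 3) E) := inferInstanceAs (Countable (Fin 3 → Fin 3 → E))
      haveI : Countable (GL (Fin 3) E) := Units.val_injective.countable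
      haveI : Countable (quasiSplit F E c 3).Rational :=
        inferInstanceAs (Countable (rational F E c 3 ((StdForm.antidiagonal 3).over E)))
      exact (Set.countable_range _).to_subtype
    have h1 : Function.Injective fun γ : rationalUnipotent F E c 3 =>
        (⟨((γ : adelicUnipotent F E c 3) : (quasiSplit F E c 3).Adelic), γ.2⟩ : (quasiSplit F E c 3).arithmeticSubgroup) := fun a' b' h =>
      Subtype.ext (Subtype.ext (congrArg (fun z : (quasiSplit F E c 3).arithmeticSubgroup => (z : (quasiSplit F E c 3).Adelic)) h))
    exact h1.countable
  obtain ⟨K₀⟩ := (inferInstance : Nonempty (TopologicalSpace.PositiveCompacts (AdeleRing (𝓞 E) E)))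
  set μX : Measure (AdeleRing (𝓞 E) E) := Measure.addHaarMeasure K₀ with hμX
  -- (a) `N(F)`-invariance: replace `Ω'` by the Heisenberg box
  have hinv : ∀ (γ : rationalUnipotent F E c 3) (n : adelicUnipotent F E c 3),
      (fun z : (quasiSplit F E c 3).Adelic => kernelBorelClass ν 𝓕 (fun γ : (quasiSplit F E c 3).arithmeticSubgroup => (((adelicVal F E c 3 _ (γ : (quasiSplit F E c 3).Adelic) :
          GL (Fin 3) (AdeleRing (𝓞 E) E)) : Matrix (Fin 3) (Fin 3) (AdeleRing (𝓞 E) E)).charpoly,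
        decide (∃ δ : (quasiSplit F E c 3).arithmeticSubgroup, δ * γ * δ⁻¹ ∈ arithmeticBorel F E c 3)))
      ((Polynomial.map (algebraMap E (AdeleRing (𝓞 E) E)) ((X - C (a : E)) ^ 2 * (X - C (b : E)))), true) f (z) (z) -
        ∑' ξ : E, (μY (traceZeroFundamentalDomain F E c)).toReal⁻¹ • ∫ w : traceZeroAdele F E c, f (((((heisElt hc (algebraMap E (AdeleRing (𝓞 E) E) ξ) 0 : unipotentInBorel F E c 3) : borelAdelic F E c 3) : (quasiSplit F E c 3).Adelic) * z)⁻¹ * ((γ₀ : (quasiSplit F E c 3).Adelic) * (((heisElt hc 0 w : unipotentInBorel F E c 3) : borelAdelic F E c 3) : (quasiSplit F E c 3).Adelic)) * ((((heisElt hc (algebraMap E (AdeleRing (𝓞 E) E) ξ) 0 : unipotentInBorel F E c 3) : borelAdelic F E c 3) : (quasiSplit F E c 3).Adelic) * z)) ∂μY) (((γ • n : adelicUnipotent F E c 3) : (quasiSplit F E c 3).Adelic) * g) =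
      (fun z : (quasiSplit F E c 3).Adelic => kernelBorelClass ν 𝓕 (fun γ : (quasiSplit F E c 3).arithmeticSubgroup => (((adelicVal F E c 3 _ (γ : (quasiSplit F E c 3).Adelic) :
          GL (Fin 3) (AdeleRing (𝓞 E) E)) : Matrix (Fin 3) (Fin 3) (AdeleRing (𝓞 E) E)).charpoly,
        decide (∃ δ : (quasiSplit F E c 3).arithmeticSubgroup, δ * γ * δ⁻¹ ∈ arithmeticBorel F E c 3)))
      ((Polynomial.map (algebraMap E (AdeleRing (𝓞 E) E)) ((X - C (a : E)) ^ 2 * (X - C (b : E)))), true) f (z) (z) -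
        ∑' ξ : E, (μY (traceZeroFundamentalDomain F E c)).toReal⁻¹ • ∫ w : traceZeroAdele F E c, f (((((heisElt hc (algebraMap E (AdeleRing (𝓞 E) E) ξ) 0 : unipotentInBorel F E c 3) : borelAdelic F E c 3) : (quasiSplit F E c 3).Adelic) * z)⁻¹ * ((γ₀ : (quasiSplit F E c 3).Adelic) * (((heisElt hc 0 w : unipotentInBorel F E c 3) : borelAdelic F E c 3) : (quasiSplit F E c 3).Adelic)) * ((((heisElt hc (algebraMap E (AdeleRing (𝓞 E) E) ξ) 0 : unipotentInBorel F E c 3) : borelAdelic F E c 3) : (quasiSplit F E c 3).Adelic) * z)) ∂μY) ((n : (quasiSplit F E c 3).Adelic) * g) := by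
    intro γ n
    have hbB : (⟨((γ : adelicUnipotent F E c 3) : (quasiSplit F E c 3).Adelic), γ.2⟩ : (quasiSplit F E c 3).arithmeticSubgroup) ∈ arithmeticBorel F E c 3 :=
      (mem_arithmeticBorel_iff _).2 (adelicUnipotent_le_borelAdelic (γ : adelicUnipotent F E c 3).2)
    have h := singularDefect_rational_borel_mul hc hc1 hg₀ hγ₀ hab ν h𝓕 μY f _ hbB ((n : (quasiSplit F E c 3).Adelic) * g)
    rw [Subgroup.smul_def, smul_eq_mul, Subgroup.coe_mul, mul_assoc]
    exact h
  rw [hΩ'.setIntegral_eq (isFundamentalDomain_heisFundamentalDomain (F := F) (E := E) (c := c) hc ν) hinv]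
  -- (b) `ν = r • heisChart_*(μX ⊗ μY)`
  obtain ⟨r, -, hν⟩ := exists_eq_smul_map_prod_heisChart hc μX μY ν
  have hres : ν.restrict (heisFundamentalDomain F E c hc) =
      ((r : ℝ≥0∞) • (μX.prod μY).map (heisChart hc)).restrict (heisFundamentalDomain F E c hc) := by rw [← hν]
  rw [hres, Measure.restrict_smul, integral_smul_measure]
  -- (c) pull back along the chart
  rw [heisFundamentalDomain, (heisChart hc).measurableEmbedding.setIntegral_map,
    (heisChart hc).injective.preimage_image]
  -- (d) pointwise on the box
  have hclN := isUnipotentInvariantOnBorel_borelRefine (isUnipotentInvariantOnBorel_charpoly_adelicVal (F := F) (E := E) (c := c) (N := 3))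
  have hKB := kernelBorelClass_singular_diag_eq_smul_integral_center_heis hc hg₀ hγ₀ hab ha hb ν h𝓕 μX μY hfc hf g
  have hpt : ∀ p : AdeleRing (𝓞 E) E × traceZeroAdele F E c,
      (fun z : (quasiSplit F E c 3).Adelic => kernelBorelClass ν 𝓕 (fun γ : (quasiSplit F E c 3).arithmeticSubgroup => (((adelicVal F E c 3 _ (γ : (quasiSplit F E c 3).Adelic) :
          GL (Fin 3) (AdeleRing (𝓞 E) E)) : Matrix (Fin 3) (Fin 3) (AdeleRing (𝓞 E) E)).charpoly,
        decide (∃ δ : (quasiSplit F E c 3).arithmeticSubgroup, δ * γ * δ⁻¹ ∈ arithmeticBorel F E c 3)))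
      ((Polynomial.map (algebraMap E (AdeleRing (𝓞 E) E)) ((X - C (a : E)) ^ 2 * (X - C (b : E)))), true) f (z) (z) -
        ∑' ξ : E, (μY (traceZeroFundamentalDomain F E c)).toReal⁻¹ • ∫ w : traceZeroAdele F E c, f (((((heisElt hc (algebraMap E (AdeleRing (𝓞 E) E) ξ) 0 : unipotentInBorel F E c 3) : borelAdelic F E c 3) : (quasiSplit F E c 3).Adelic) * z)⁻¹ * ((γ₀ : (quasiSplit F E c 3).Adelic) * (((heisElt hc 0 w : unipotentInBorel F E c 3) : borelAdelic F E c 3) : (quasiSplit F E c 3).Adelic)) * ((((heisElt hc (algebraMap E (AdeleRing (𝓞 E) E) ξ) 0 : unipotentInBorel F E c 3) : borelAdelic F E c 3) : (quasiSplit F E c 3).Adelic) * z)) ∂μY) (((heisChart hc p : adelicUnipotent F E c 3) : (quasiSplit F E c 3).Adelic) * g) =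
      (μX.real (adeleFundamentalDomain E))⁻¹ • (∫ x : AdeleRing (𝓞 E) E, (μY (traceZeroFundamentalDomain F E c)).toReal⁻¹ • ∫ w : traceZeroAdele F E c, f (((((heisElt hc (x) 0 : unipotentInBorel F E c 3) : borelAdelic F E c 3) : (quasiSplit F E c 3).Adelic) * g)⁻¹ * ((γ₀ : (quasiSplit F E c 3).Adelic) * (((heisElt hc 0 w : unipotentInBorel F E c 3) : borelAdelic F E c 3) : (quasiSplit F E c 3).Adelic)) * ((((heisElt hc (x) 0 : unipotentInBorel F E c 3) : borelAdelic F E c 3) : (quasiSplit F E c 3).Adelic) * g)) ∂μY ∂μX) -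
        ∑' ξ : E, (μY (traceZeroFundamentalDomain F E c)).toReal⁻¹ • ∫ w : traceZeroAdele F E c, f (((((heisElt hc (algebraMap E (AdeleRing (𝓞 E) E) ξ + p.1) 0 : unipotentInBorel F E c 3) : borelAdelic F E c 3) : (quasiSplit F E c 3).Adelic) * g)⁻¹ * ((γ₀ : (quasiSplit F E c 3).Adelic) * (((heisElt hc 0 w : unipotentInBorel F E c 3) : borelAdelic F E c 3) : (quasiSplit F E c 3).Adelic)) * ((((heisElt hc (algebraMap E (AdeleRing (𝓞 E) E) ξ + p.1) 0 : unipotentInBorel F E c 3) : borelAdelic F E c 3) : (quasiSplit F E c 3).Adelic) * g)) ∂μY := by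
    rintro ⟨x, w⟩
    have hK := kernelBorelClass_diag_borel_mul hc hc1 ν h𝓕 hclN hfc hf
      ⟨((heisChart hc (x, w) : adelicUnipotent F E c 3) : (quasiSplit F E c 3).Adelic), adelicUnipotent_le_borelAdelic (heisChart hc (x, w)).2⟩ g ((Polynomial.map (algebraMap E (AdeleRing (𝓞 E) E)) ((X - C (a : E)) ^ 2 * (X - C (b : E)))), true)
    rw [torusRootModulus_diagUnit_eq_one_of_mem_adelicUnipotent (heisChart hc (x, w)).2, NNReal.coe_one, one_smul] at hK
    simp only []
    rw [hK, hKB, tsum_center_heis_mul_heisChart_mul hc hg₀ hγ₀ μY f x w g]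
  simp_rw [hpt]
  -- (e) integrate out `w`, (f) the `x`-line defect vanishes
  have hG : Integrable (fun x : AdeleRing (𝓞 E) E => (μY (traceZeroFundamentalDomain F E c)).toReal⁻¹ • ∫ w : traceZeroAdele F E c, f (((((heisElt hc (x) 0 : unipotentInBorel F E c 3) : borelAdelic F E c 3) : (quasiSplit F E c 3).Adelic) * g)⁻¹ * ((γ₀ : (quasiSplit F E c 3).Adelic) * (((heisElt hc 0 w : unipotentInBorel F E c 3) : borelAdelic F E c 3) : (quasiSplit F E c 3).Adelic)) * ((((heisElt hc (x) 0 : unipotentInBorel F E c 3) : borelAdelic F E c 3) : (quasiSplit F E c 3).Adelic) * g)) ∂μY) μX := by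
    have hF2 := (integral_integral_singularKernel_swap hc hab hg₀ hγ₀ (hasCompactSupport_conj hf g) (continuous_conj hfc g) μX μY).1
    have h := (hF2.integral_prod_left).smul ((μY (traceZeroFundamentalDomain F E c)).toReal⁻¹)
    refine h.congr (Filter.Eventually.of_forall fun x => ?_)
    rw [Pi.smul_apply]
    simp only [inv_mul_mul_mul_eq_conj_conj']
  have hfst := integral_fun_fst (μ := μX.restrict (adeleFundamentalDomain E))
    (ν := μY.restrict (traceZeroFundamentalDomain F E c))
    (fun x : AdeleRing (𝓞 E) E => (μX.real (adeleFundamentalDomain E))⁻¹ • (∫ x : AdeleRing (𝓞 E) E, (μY (traceZeroFundamentalDomain F E c)).toReal⁻¹ • ∫ w : traceZeroAdele F E c, f (((((heisElt hc (x) 0 : unipotentInBorel F E c 3) : borelAdelic F E c 3) : (quasiSplit F E c 3).Adelic) * g)⁻¹ * ((γ₀ : (quasiSplit F E c 3).Adelic) * (((heisElt hc 0 w : unipotentInBorel F E c 3) : borelAdelic F E c 3) : (quasiSplit F E c 3).Adelic)) * ((((heisElt hc (x) 0 : unipotentInBorel F E c 3) : borelAdelic F E c 3) : (quasiSplit F E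 c 3).Adelic) * g)) ∂μY ∂μX) -
        ∑' ξ : E, (μY (traceZeroFundamentalDomain F E c)).toReal⁻¹ • ∫ w : traceZeroAdele F E c, f (((((heisElt hc (algebraMap E (AdeleRing (𝓞 E) E) ξ + x) 0 : unipotentInBorel F E c 3) : borelAdelic F E c 3) : (quasiSplit F E c 3).Adelic) * g)⁻¹ * ((γ₀ : (quasiSplit F E c 3).Adelic) * (((heisElt hc 0 w : unipotentInBorel F E c 3) : borelAdelic F E c 3) : (quasiSplit F E c 3).Adelic)) * ((((heisElt hc (algebraMap E (AdeleRing (𝓞 E) E) ξ + x) 0 : unipotentInBorel F E c 3) : borelAdelic F E c 3) : (quasiSplit F E c 3).Adelic) * g)) ∂μY)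
  rw [Measure.prod_restrict] at hfst
  rw [hfst, setIntegral_adeleFundamentalDomain_defect_eq_zero μX hG, smul_zero, smul_zero]

end Fibre


/-! ## §8 The assembly: `J^T_{i♭}(f) = ∫_X Σ'_{[γ₀]} f(x̃⁻¹ s x̃) dμ + c_μ ∫_G β•b_T dν_G` -/

section Assembly

variable [MeasurableSpace (AdeleRing (𝓞 E) E)] [BorelSpace (AdeleRing (𝓞 E) E)]
  [MeasurableSpace (adelicUnipotent F E c 3)] [BorelSpace (adelicUnipotent F E c 3)]
  [MeasurableSpace (quasiSplit F E c 3).Adelic] [BorelSpace (quasiSplit F E c 3).Adelic]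

/-- **ROGAWSKI'S PROP. 7.2.1 ⇒ (7.2.3) AT FINITE `T`, GENERIC FORM.**  `U(J₃)` of a quadratic `E/F` (`c² = 1 ≠ c`), unimodular
`G(𝔸_F)` (`hunimod`) with the adelic Iwasawa decomposition (`hBK`); the singular base point `γ₀ = ι(d(a,b,a))`
(`a ≠ b`, `c a·a = c b·b = 1`) and its refined class `i♭`; a Haar measure `ν` of `N(𝔸_F)` with a fundamental domain `𝓕`
(the data of `K_{B,i♭}` and `k^T_{i♭}`), an automorphic measure `μ`, an inversion-invariant Haar measure `ν_G` of `G(𝔸_F)`,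
an additive Haar measure `μY` of `𝔸_E⁻` (the normalisation of the bracket), `f ∈ C_c`, a covering weight `β` of `B_{γ₀}(F)♯`
and `T ≥ 1`. HYPOTHESES: `[g] ↦ k^T_{i♭}(g⁻¹)` and `[g] ↦ Σ'_{s∈[γ₀]} f(g s g⁻¹)` are `μ`-integrable (★ LAW 3a ∕ ★ (b1)) and the
bracket is absolutely integrable against `β` (★ (b2-β) `lintegral_weight_mul_enorm_singularBracket_lt_top`). CONCLUSION:

  `J^T_{i♭}(f) = ∫_X Σ'_{s ∈ [γ₀]} f(x̃⁻¹ s x̃)⁻… dμ(x) + c_μ · ∫_{G(𝔸)} (β g) • b_T(g) dν_G(g)`,  `c_μ = unfoldingConstant G(F) count μ ν_G`.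

PROOF: unfold `Σ'_{q ∈ B_γ(F)\\G(F)} b_T(q̃ ·)` (★ p07 `integrable_tsum_quotient_and_integral_eq_mul_integral_of_subgroup`); by the
comparison identity (★ B′1 `summable_and_tsum_singularBracket_quotient_eq`) it equals `k^T − S + Σ_δ(1_{T<H}𝓔)(δ·)` pointwise, so
the descended defect series is `μ`-integrable BY DIFFERENCE; its integral vanishes by ★ FILE A′
`integral_quotFun_pseudoEisenstein_indicator_eq_zero_of_fibre` fed with the `x`-fibre identity
`setIntegral_singularDefect_unipotent_mul_eq_zero`. [cite: Rogawski1990, §7.2 Prop. 7.2.1, (7.2.2)–(7.2.3) (pp. 91–93)]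
[cite: Arthur1978TraceFormulaI, §8] [cite: Gelbart1975, §9.B] -/
theorem truncatedTraceClass_singular_eq_integral_add_mul_integral_singularBracket (hc : c * c = 1) (hc1 : c ≠ 1)
    (hunimod : ∀ (νG' : Measure (quasiSplit F E c 3).Adelic), νG'.IsHaarMeasure → νG'.IsMulRightInvariant)
    (hBK : ∀ g : (quasiSplit F E c 3).Adelic, ∃ b ∈ borelAdelic F E c 3, ∃ k : (quasiSplit F E c 3).Adelic,
      adelicVal F E c 3 ((StdForm.antidiagonal 3).over E) k ∈ standardMaximalCompactGL 3 E ∧ g = b * k)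
    {a b : Eˣ} {g₀ : (quasiSplit F E c 3).Rational} {γ₀ : (quasiSplit F E c 3).arithmeticSubgroup}
    (hg₀ : ((g₀.val : GL (Fin 3) E) : Matrix (Fin 3) (Fin 3) E) = !![(a : E), 0, 0; 0, b, 0; 0, 0, a])
    (hγ₀ : (γ₀ : (quasiSplit F E c 3).Adelic) = (quasiSplit F E c 3).toAdelic g₀)
    (hab : (a : E) ≠ (b : E)) (ha : c (a : E) * (a : E) = 1) (hb : c (b : E) * (b : E) = 1)
    (ν : Measure (adelicUnipotent F E c 3)) [ν.IsHaarMeasure]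
    {𝓕 : Set (adelicUnipotent F E c 3)} (h𝓕 : IsFundamentalDomain (rationalUnipotent F E c 3) 𝓕 ν)
    (μ : Measure (quasiSplit F E c 3).automorphicQuotient) [(quasiSplit F E c 3).IsAutomorphicMeasure μ]
    (νG : Measure (quasiSplit F E c 3).Adelic) [νG.IsHaarMeasure] [νG.IsInvInvariant]
    (μY : Measure (traceZeroAdele F E c)) [μY.IsAddHaarMeasure] [μY.Regular]
    {f : (quasiSplit F E c 3).Adelic → ℂ} (hfc : Continuous f) (hf : HasCompactSupport f)
    {β : (quasiSplit F E c 3).Adelic → ℝ≥0∞}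
    (hβ : IsCoveringWeight ((arithmeticBorel F E c 3 ⊓ Subgroup.centralizer ({γ₀} : Set (quasiSplit F E c 3).arithmeticSubgroup)).map (quasiSplit F E c 3).arithmeticSubgroup.subtype) β)
    {T : ℝ≥0} (hT : 1 ≤ T)
    (hkT : Integrable ((quasiSplit F E c 3).quotFun (truncatedKernelClass ν 𝓕 T (fun γ : (quasiSplit F E c 3).arithmeticSubgroup => (((adelicVal F E c 3 _ (γ : (quasiSplit F E c 3).Adelic) :
          GL (Fin 3) (AdeleRing (𝓞 E) E)) : Matrix (Fin 3) (Fin 3) (AdeleRing (𝓞 E) E)).charpoly,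
        decide (∃ δ : (quasiSplit F E c 3).arithmeticSubgroup, δ * γ * δ⁻¹ ∈ arithmeticBorel F E c 3))) ((Polynomial.map (algebraMap E (AdeleRing (𝓞 E) E)) ((X - C (a : E)) ^ 2 * (X - C (b : E)))), true) f)) μ)
    (hS : Integrable ((quasiSplit F E c 3).quotFun (fun y : (quasiSplit F E c 3).Adelic => ∑' s : ↥(conjOrbit (quasiSplit F E c 3).arithmeticSubgroup (γ₀ : (quasiSplit F E c 3).Adelic)), f (y⁻¹ * (s : (quasiSplit F E c 3).Adelic) * y))) μ)
    (hbint : ∫⁻ g, β g * ‖(fun y : (quasiSplit F E c 3).Adelic => (∑' n : {n : ↥((adelicUnipotent F E c 3).subgroupOf (quasiSplit F E c 3).arithmeticSubgroup ⊓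
        Subgroup.centralizer ({γ₀} : Set (quasiSplit F E c 3).arithmeticSubgroup)) // n ≠ 1},
      f (y⁻¹ * (((n.1 : (quasiSplit F E c 3).arithmeticSubgroup) * γ₀ : (quasiSplit F E c 3).arithmeticSubgroup) : (quasiSplit F E c 3).Adelic) * y)) -
      Set.indicator {y : (quasiSplit F E c 3).Adelic | T < borelHeight y}
        (fun y : (quasiSplit F E c 3).Adelic => (μY (traceZeroFundamentalDomain F E c)).toReal⁻¹ • ∫ w : traceZeroAdele F E c, f (y⁻¹ * ((γ₀ : (quasiSplit F E c 3).Adelic) * (((heisElt hc 0 w : unipotentInBorel F E c 3) : borelAdelic F E c 3) : (quasiSplit F E c 3).Adelic)) * y) ∂μY) y) g‖ₑ ∂νG < ⊤) :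
    haveI := t2Space_adeleRing_of_numberField E
    haveI := locallyCompactSpace_adeleRing' E
    haveI := secondCountableTopology_adeleRing E
    haveI : T2Space (quasiSplit F E c 3).Adelic :=
      inferInstanceAs (T2Space (adelic F E c 3 ((StdForm.antidiagonal 3).over E)))
    haveI : LocallyCompactSpace (quasiSplit F E c 3).Adelic :=
      inferInstanceAs (LocallyCompactSpace (adelic F E c 3 ((StdForm.antidiagonal 3).over E)))
    haveI : SecondCountableTopology (quasiSplit F E c 3).Adelic :=
      inferInstanceAs (SecondCountableTopology (adelic F E c 3 ((StdForm.antidiagonal 3).over E)))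
    haveI : DiscreteTopology (quasiSplit F E c 3).quotientSubgroup := by
      rw [quotientSubgroup_quasiSplit]; exact isDiscreteRational_quasiSplit
    letI := AdelicGroupData.measurableSpaceQuotientForm (quasiSplit F E c 3)
    haveI := AdelicGroupData.borelSpaceQuotientForm (quasiSplit F E c 3)
    haveI := AdelicGroupData.smulInvariantMeasureQuotientForm (quasiSplit F E c 3) μ
    haveI := AdelicGroupData.isFiniteMeasureOnCompactsQuotientForm (quasiSplit F E c 3) μ
    truncatedTraceClass μ ν 𝓕 T (fun γ : (quasiSplit F E c 3).arithmeticSubgroup => (((adelicVal F E c 3 _ (γ : (quasiSplit F E c 3).Adelic) :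
          GL (Fin 3) (AdeleRing (𝓞 E) E)) : Matrix (Fin 3) (Fin 3) (AdeleRing (𝓞 E) E)).charpoly,
        decide (∃ δ : (quasiSplit F E c 3).arithmeticSubgroup, δ * γ * δ⁻¹ ∈ arithmeticBorel F E c 3))) ((Polynomial.map (algebraMap E (AdeleRing (𝓞 E) E)) ((X - C (a : E)) ^ 2 * (X - C (b : E)))), true) f =
      (∫ x, (quasiSplit F E c 3).quotFun (fun y : (quasiSplit F E c 3).Adelic => ∑' s : ↥(conjOrbit (quasiSplit F E c 3).arithmeticSubgroup (γ₀ : (quasiSplit F E c 3).Adelic)), f (y⁻¹ * (s : (quasiSplit F E c 3).Adelic) * y)) x ∂μ) +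
        ((unfoldingConstant (quasiSplit F E c 3).quotientSubgroup
            (count : Measure (quasiSplit F E c 3).quotientSubgroup) μ νG : ℝ) : ℂ) *
          ∫ g, (β g).toReal • (fun y : (quasiSplit F E c 3).Adelic => (∑' n : {n : ↥((adelicUnipotent F E c 3).subgroupOf (quasiSplit F E c 3).arithmeticSubgroup ⊓
        Subgroup.centralizer ({γ₀} : Set (quasiSplit F E c 3).arithmeticSubgroup)) // n ≠ 1},
      f (y⁻¹ * (((n.1 : (quasiSplit F E c 3).arithmeticSubgroup) * γ₀ : (quasiSplit F E c 3).arithmeticSubgroup) : (quasiSplit F E c 3).Adelic) * y)) -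
      Set.indicator {y : (quasiSplit F E c 3).Adelic | T < borelHeight y}
        (fun y : (quasiSplit F E c 3).Adelic => (μY (traceZeroFundamentalDomain F E c)).toReal⁻¹ • ∫ w : traceZeroAdele F E c, f (y⁻¹ * ((γ₀ : (quasiSplit F E c 3).Adelic) * (((heisElt hc 0 w : unipotentInBorel F E c 3) : borelAdelic F E c 3) : (quasiSplit F E c 3).Adelic)) * y) ∂μY) y) g ∂νG := by
  haveI := t2Space_adeleRing_of_numberField E
  haveI := locallyCompactSpace_adeleRing' E
  haveI := secondCountableTopology_adeleRing E
  haveI : T2Space (quasiSplit F E c 3).Adelic :=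
    inferInstanceAs (T2Space (adelic F E c 3 ((StdForm.antidiagonal 3).over E)))
  haveI : LocallyCompactSpace (quasiSplit F E c 3).Adelic :=
    inferInstanceAs (LocallyCompactSpace (adelic F E c 3 ((StdForm.antidiagonal 3).over E)))
  haveI : SecondCountableTopology (quasiSplit F E c 3).Adelic :=
    inferInstanceAs (SecondCountableTopology (adelic F E c 3 ((StdForm.antidiagonal 3).over E)))
  haveI : DiscreteTopology (quasiSplit F E c 3).quotientSubgroup := by
    rw [quotientSubgroup_quasiSplit]; exact isDiscreteRational_quasiSplit
  letI := AdelicGroupData.measurableSpaceQuotientForm (quasiSplit F E c 3)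
  haveI := AdelicGroupData.borelSpaceQuotientForm (quasiSplit F E c 3)
  haveI := AdelicGroupData.smulInvariantMeasureQuotientForm (quasiSplit F E c 3) μ
  haveI := AdelicGroupData.isFiniteMeasureOnCompactsQuotientForm (quasiSplit F E c 3) μ
  have hT0 : 0 < T := lt_of_lt_of_le one_pos hT
  haveI : SFinite μY := by
    haveI := locallyCompactSpace_traceZeroAdele (F := F) (E := E) (c := c)
    haveI : SecondCountableTopology (traceZeroAdele F E c) := TopologicalSpace.Subtype.secondCountableTopology _
    haveI : SigmaFinite μY := MeasureTheory.Measure.IsAddHaarMeasure.sigmaFinite μY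
    infer_instance
  haveI : SFinite ν := by
    have hcl' : IsClosed ((adelicUnipotent F E c 3 : Set (quasiSplit F E c 3).Adelic)) := by
      change IsClosed (⇑(adelicVal F E c 3 ((StdForm.antidiagonal 3).over E)) ⁻¹'
        ((upperUnitriangular (Fin 3) (AdeleRing (𝓞 E) E) : Subgroup (GL (Fin 3) (AdeleRing (𝓞 E) E))) :
          Set (GL (Fin 3) (AdeleRing (𝓞 E) E))))
      exact (isClosed_upperUnitriangular (R := AdeleRing (𝓞 E) E)).preimage continuous_subtype_val
    haveI : LocallyCompactSpace (adelicUnipotent F E c 3) := hcl'.locallyCompactSpace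
    haveI : SecondCountableTopology (adelicUnipotent F E c 3) := TopologicalSpace.Subtype.secondCountableTopology _
    haveI : SigmaFinite ν := MeasureTheory.Measure.IsHaarMeasure.sigmaFinite ν
    infer_instance
  -- (1) unfolding of the bracket at `Λ = B_γ(F)`
  have hψm : Measurable (fun y : (quasiSplit F E c 3).Adelic => (∑' n : {n : ↥((adelicUnipotent F E c 3).subgroupOf (quasiSplit F E c 3).arithmeticSubgroup ⊓
        Subgroup.centralizer ({γ₀} : Set (quasiSplit F E c 3).arithmeticSubgroup)) // n ≠ 1},
      f (y⁻¹ * (((n.1 : (quasiSplit F E c 3).arithmeticSubgroup) * γ₀ : (quasiSplit F E c 3).arithmeticSubgroup) : (quasiSplit F E c 3).Adelic) * y)) -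
      Set.indicator {y : (quasiSplit F E c 3).Adelic | T < borelHeight y}
        (fun y : (quasiSplit F E c 3).Adelic => (μY (traceZeroFundamentalDomain F E c)).toReal⁻¹ • ∫ w : traceZeroAdele F E c, f (y⁻¹ * ((γ₀ : (quasiSplit F E c 3).Adelic) * (((heisElt hc 0 w : unipotentInBorel F E c 3) : borelAdelic F E c 3) : (quasiSplit F E c 3).Adelic)) * y) ∂μY) y) := measurable_singularBracket hc γ₀ μY T hfc
  have hψinv : ∀ l ∈ (arithmeticBorel F E c 3 ⊓ Subgroup.centralizer ({γ₀} : Set (quasiSplit F E c 3).arithmeticSubgroup)), ∀ y : (quasiSplit F E c 3).Adelic, (fun y : (quasiSplit F E c 3).Adelic => (∑' n : {n : ↥((adelicUnipotent F E c 3).subgroupOf (quasiSplit F E c 3).arithmeticSubgroup ⊓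
        Subgroup.centralizer ({γ₀} : Set (quasiSplit F E c 3).arithmeticSubgroup)) // n ≠ 1},
      f (y⁻¹ * (((n.1 : (quasiSplit F E c 3).arithmeticSubgroup) * γ₀ : (quasiSplit F E c 3).arithmeticSubgroup) : (quasiSplit F E c 3).Adelic) * y)) -
      Set.indicator {y : (quasiSplit F E c 3).Adelic | T < borelHeight y}
        (fun y : (quasiSplit F E c 3).Adelic => (μY (traceZeroFundamentalDomain F E c)).toReal⁻¹ • ∫ w : traceZeroAdele F E c, f (y⁻¹ * ((γ₀ : (quasiSplit F E c 3).Adelic) * (((heisElt hc 0 w : unipotentInBorel F E c 3) : borelAdelic F E c 3) : (quasiSplit F E c 3).Adelic)) * y) ∂μY) y) ((l : (quasiSplit F E c 3).Adelic) * y) = (fun y : (quasiSplit F E c 3).Adelic => (∑' n : {n : ↥((adelicUnipotent F E c 3).subgroupOf (quasiSplit F E c 3).arithmeticSubgroup ⊓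
        Subgroup.centralizer ({γ₀} : Set (quasiSplit F E c 3).arithmeticSubgroup)) // n ≠ 1},
      f (y⁻¹ * (((n.1 : (quasiSplit F E c 3).arithmeticSubgroup) * γ₀ : (quasiSplit F E c 3).arithmeticSubgroup) : (quasiSplit F E c 3).Adelic) * y)) -
      Set.indicator {y : (quasiSplit F E c 3).Adelic | T < borelHeight y}
        (fun y : (quasiSplit F E c 3).Adelic => (μY (traceZeroFundamentalDomain F E c)).toReal⁻¹ • ∫ w : traceZeroAdele F E c, f (y⁻¹ * ((γ₀ : (quasiSplit F E c 3).Adelic) * (((heisElt hc 0 w : unipotentInBorel F E c 3) : borelAdelic F E c 3) : (quasiSplit F E c 3).Adelic)) * y) ∂μY) y) y :=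
    fun l hl y => singularBracket_borelCentralizer_mul hc hc1 γ₀ μY T f hl y
  obtain ⟨hInt, hUnf⟩ := integrable_tsum_quotient_and_integral_eq_mul_integral_of_subgroup μ νG hβ hψm hψinv hbint
  -- (2) the comparison identity, pointwise on the quotient
  have hpt : ∀ x : (quasiSplit F E c 3).automorphicQuotient,
      (∑' q : Quotient (QuotientGroup.rightRel (arithmeticBorel F E c 3 ⊓ Subgroup.centralizer ({γ₀} : Set (quasiSplit F E c 3).arithmeticSubgroup))), (fun y : (quasiSplit F E c 3).Adelic => (∑' n : {n : ↥((adelicUnipotent F E c 3).subgroupOf (quasiSplit F E c 3).arithmeticSubgroup ⊓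
        Subgroup.centralizer ({γ₀} : Set (quasiSplit F E c 3).arithmeticSubgroup)) // n ≠ 1},
      f (y⁻¹ * (((n.1 : (quasiSplit F E c 3).arithmeticSubgroup) * γ₀ : (quasiSplit F E c 3).arithmeticSubgroup) : (quasiSplit F E c 3).Adelic) * y)) -
      Set.indicator {y : (quasiSplit F E c 3).Adelic | T < borelHeight y}
        (fun y : (quasiSplit F E c 3).Adelic => (μY (traceZeroFundamentalDomain F E c)).toReal⁻¹ • ∫ w : traceZeroAdele F E c, f (y⁻¹ * ((γ₀ : (quasiSplit F E c 3).Adelic) * (((heisElt hc 0 w : unipotentInBorel F E c 3) : borelAdelic F E c 3) : (quasiSplit F E c 3).Adelic)) * y) ∂μY) y) (((q.out : (quasiSplit F E c 3).arithmeticSubgroup) : (quasiSplit F E c 3).Adelic) * (Quotient.out x : (quasiSplit F E c 3).Adelic)⁻¹)) =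
        (quasiSplit F E c 3).quotFun (truncatedKernelClass ν 𝓕 T (fun γ : (quasiSplit F E c 3).arithmeticSubgroup => (((adelicVal F E c 3 _ (γ : (quasiSplit F E c 3).Adelic) :
          GL (Fin 3) (AdeleRing (𝓞 E) E)) : Matrix (Fin 3) (Fin 3) (AdeleRing (𝓞 E) E)).charpoly,
        decide (∃ δ : (quasiSplit F E c 3).arithmeticSubgroup, δ * γ * δ⁻¹ ∈ arithmeticBorel F E c 3))) ((Polynomial.map (algebraMap E (AdeleRing (𝓞 E) E)) ((X - C (a : E)) ^ 2 * (X - C (b : E)))), true) f) x -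
          (quasiSplit F E c 3).quotFun (fun y : (quasiSplit F E c 3).Adelic => ∑' s : ↥(conjOrbit (quasiSplit F E c 3).arithmeticSubgroup (γ₀ : (quasiSplit F E c 3).Adelic)), f (y⁻¹ * (s : (quasiSplit F E c 3).Adelic) * y)) x +
          (quasiSplit F E c 3).quotFun (pseudoEisenstein ({y : (quasiSplit F E c 3).Adelic | T < borelHeight y}.indicator (fun z : (quasiSplit F E c 3).Adelic => kernelBorelClass ν 𝓕 (fun γ : (quasiSplit F E c 3).arithmeticSubgroup => (((adelicVal F E c 3 _ (γ : (quasiSplit F E c 3).Adelic) :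
          GL (Fin 3) (AdeleRing (𝓞 E) E)) : Matrix (Fin 3) (Fin 3) (AdeleRing (𝓞 E) E)).charpoly,
        decide (∃ δ : (quasiSplit F E c 3).arithmeticSubgroup, δ * γ * δ⁻¹ ∈ arithmeticBorel F E c 3)))
      ((Polynomial.map (algebraMap E (AdeleRing (𝓞 E) E)) ((X - C (a : E)) ^ 2 * (X - C (b : E)))), true) f z z -
        ∑' ξ : E, (μY (traceZeroFundamentalDomain F E c)).toReal⁻¹ • ∫ w : traceZeroAdele F E c, f (((((heisElt hc (algebraMap E (AdeleRing (𝓞 E) E) ξ) 0 : unipotentInBorel F E c 3) : borelAdelic F E c 3) : (quasiSplit F E c 3).Adelic) * z)⁻¹ * ((γ₀ : (quasiSplit F E c 3).Adelic) * (((heisElt hc 0 w : unipotentInBorel F E c 3) : borelAdelic F E c 3) : (quasiSplit F E c 3).Adelic)) * ((((heisElt hc (algebraMap E (AdeleRing (𝓞 E) E) ξ) 0 : unipotentInBorel F E c 3) : borelAdelic F E c 3) : (quasiSplit F E c 3).Adelic) * z)) ∂μY))) x := fun x =>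
    (summable_and_tsum_singularBracket_quotient_eq hc hc1 hg₀ hγ₀ hab ha hb ν 𝓕 μY hf hT0
      ((Quotient.out x : (quasiSplit F E c 3).Adelic)⁻¹)).2
  -- (3) the descended defect series is integrable by difference
  have hEfun : (quasiSplit F E c 3).quotFun (pseudoEisenstein ({y : (quasiSplit F E c 3).Adelic | T < borelHeight y}.indicator (fun z : (quasiSplit F E c 3).Adelic => kernelBorelClass ν 𝓕 (fun γ : (quasiSplit F E c 3).arithmeticSubgroup => (((adelicVal F E c 3 _ (γ : (quasiSplit F E c 3).Adelic) :
          GL (Fin 3) (AdeleRing (𝓞 E) E)) : Matrix (Fin 3) (Fin 3) (AdeleRing (𝓞 E) E)).charpoly,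
        decide (∃ δ : (quasiSplit F E c 3).arithmeticSubgroup, δ * γ * δ⁻¹ ∈ arithmeticBorel F E c 3)))
      ((Polynomial.map (algebraMap E (AdeleRing (𝓞 E) E)) ((X - C (a : E)) ^ 2 * (X - C (b : E)))), true) f z z -
        ∑' ξ : E, (μY (traceZeroFundamentalDomain F E c)).toReal⁻¹ • ∫ w : traceZeroAdele F E c, f (((((heisElt hc (algebraMap E (AdeleRing (𝓞 E) E) ξ) 0 : unipotentInBorel F E c 3) : borelAdelic F E c 3) : (quasiSplit F E c 3).Adelic) * z)⁻¹ * ((γ₀ : (quasiSplit F E c 3).Adelic) * (((heisElt hc 0 w : unipotentInBorel F E c 3) : borelAdelic F E c 3) : (quasiSplit F E c 3).Adelic)) * ((((heisElt hc (algebraMap E (AdeleRing (𝓞 E) E) ξ) 0 : unipotentInBorel F E c 3) : borelAdelic F E c 3) : (quasiSplit F E c 3).Adelic) * z)) ∂μY))) =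
      fun x => (∑' q : Quotient (QuotientGroup.rightRel (arithmeticBorel F E c 3 ⊓ Subgroup.centralizer ({γ₀} : Set (quasiSplit F E c 3).arithmeticSubgroup))), (fun y : (quasiSplit F E c 3).Adelic => (∑' n : {n : ↥((adelicUnipotent F E c 3).subgroupOf (quasiSplit F E c 3).arithmeticSubgroup ⊓
        Subgroup.centralizer ({γ₀} : Set (quasiSplit F E c 3).arithmeticSubgroup)) // n ≠ 1},
      f (y⁻¹ * (((n.1 : (quasiSplit F E c 3).arithmeticSubgroup) * γ₀ : (quasiSplit F E c 3).arithmeticSubgroup) : (quasiSplit F E c 3).Adelic) * y)) -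
      Set.indicator {y : (quasiSplit F E c 3).Adelic | T < borelHeight y}
        (fun y : (quasiSplit F E c 3).Adelic => (μY (traceZeroFundamentalDomain F E c)).toReal⁻¹ • ∫ w : traceZeroAdele F E c, f (y⁻¹ * ((γ₀ : (quasiSplit F E c 3).Adelic) * (((heisElt hc 0 w : unipotentInBorel F E c 3) : borelAdelic F E c 3) : (quasiSplit F E c 3).Adelic)) * y) ∂μY) y) (((q.out : (quasiSplit F E c 3).arithmeticSubgroup) : (quasiSplit F E c 3).Adelic) * (Quotient.out x : (quasiSplit F E c 3).Adelic)⁻¹)) -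
        (quasiSplit F E c 3).quotFun (truncatedKernelClass ν 𝓕 T (fun γ : (quasiSplit F E c 3).arithmeticSubgroup => (((adelicVal F E c 3 _ (γ : (quasiSplit F E c 3).Adelic) :
          GL (Fin 3) (AdeleRing (𝓞 E) E)) : Matrix (Fin 3) (Fin 3) (AdeleRing (𝓞 E) E)).charpoly,
        decide (∃ δ : (quasiSplit F E c 3).arithmeticSubgroup, δ * γ * δ⁻¹ ∈ arithmeticBorel F E c 3))) ((Polynomial.map (algebraMap E (AdeleRing (𝓞 E) E)) ((X - C (a : E)) ^ 2 * (X - C (b : E)))), true) f) x +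
        (quasiSplit F E c 3).quotFun (fun y : (quasiSplit F E c 3).Adelic => ∑' s : ↥(conjOrbit (quasiSplit F E c 3).arithmeticSubgroup (γ₀ : (quasiSplit F E c 3).Adelic)), f (y⁻¹ * (s : (quasiSplit F E c 3).Adelic) * y)) x := by
    funext x; rw [hpt x]; ring
  have hEint : Integrable ((quasiSplit F E c 3).quotFun (pseudoEisenstein ({y : (quasiSplit F E c 3).Adelic | T < borelHeight y}.indicator (fun z : (quasiSplit F E c 3).Adelic => kernelBorelClass ν 𝓕 (fun γ : (quasiSplit F E c 3).arithmeticSubgroup => (((adelicVal F E c 3 _ (γ : (quasiSplit F E c 3).Adelic) :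
          GL (Fin 3) (AdeleRing (𝓞 E) E)) : Matrix (Fin 3) (Fin 3) (AdeleRing (𝓞 E) E)).charpoly,
        decide (∃ δ : (quasiSplit F E c 3).arithmeticSubgroup, δ * γ * δ⁻¹ ∈ arithmeticBorel F E c 3)))
      ((Polynomial.map (algebraMap E (AdeleRing (𝓞 E) E)) ((X - C (a : E)) ^ 2 * (X - C (b : E)))), true) f z z -
        ∑' ξ : E, (μY (traceZeroFundamentalDomain F E c)).toReal⁻¹ • ∫ w : traceZeroAdele F E c, f (((((heisElt hc (algebraMap E (AdeleRing (𝓞 E) E) ξ) 0 : unipotentInBorel F E c 3) : borelAdelic F E c 3) : (quasiSplit F E c 3).Adelic) * z)⁻¹ * ((γ₀ : (quasiSplit F E c 3).Adelic) * (((heisElt hc 0 w : unipotentInBorel F E c 3) : borelAdelic F E c 3) : (quasiSplit F E c 3).Adelic)) * ((((heisElt hc (algebraMap E (AdeleRing (𝓞 E) E) ξ) 0 : unipotentInBorel F E c 3) : borelAdelic F E c 3) : (quasiSplit F E c 3).Adelic) * z)) ∂μY)))) μ := by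
    rw [hEfun]; exact (hInt.sub hkT).add hS
  -- (4) the defect integral vanishes (FILE A′ with the `x`-fibre identity)
  have hE0 : ∫ x, (quasiSplit F E c 3).quotFun (pseudoEisenstein ({y : (quasiSplit F E c 3).Adelic | T < borelHeight y}.indicator (fun z : (quasiSplit F E c 3).Adelic => kernelBorelClass ν 𝓕 (fun γ : (quasiSplit F E c 3).arithmeticSubgroup => (((adelicVal F E c 3 _ (γ : (quasiSplit F E c 3).Adelic) :
          GL (Fin 3) (AdeleRing (𝓞 E) E)) : Matrix (Fin 3) (Fin 3) (AdeleRing (𝓞 E) E)).charpoly,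
        decide (∃ δ : (quasiSplit F E c 3).arithmeticSubgroup, δ * γ * δ⁻¹ ∈ arithmeticBorel F E c 3)))
      ((Polynomial.map (algebraMap E (AdeleRing (𝓞 E) E)) ((X - C (a : E)) ^ 2 * (X - C (b : E)))), true) f z z -
        ∑' ξ : E, (μY (traceZeroFundamentalDomain F E c)).toReal⁻¹ • ∫ w : traceZeroAdele F E c, f (((((heisElt hc (algebraMap E (AdeleRing (𝓞 E) E) ξ) 0 : unipotentInBorel F E c 3) : borelAdelic F E c 3) : (quasiSplit F E c 3).Adelic) * z)⁻¹ * ((γ₀ : (quasiSplit F E c 3).Adelic) * (((heisElt hc 0 w : unipotentInBorel F E c 3) : borelAdelic F E c 3) : (quasiSplit F E c 3).Adelic)) * ((((heisElt hc (algebraMap E (AdeleRing (𝓞 E) E) ξ) 0 : unipotentInBorel F E c 3) : borelAdelic F E c 3) : (quasiSplit F E c 3).Adelic) * z)) ∂μY))) x ∂μ = 0 :=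
    integral_quotFun_pseudoEisenstein_indicator_eq_zero_of_fibre hc hc1 hunimod hBK ν μ
      (singularDefect_rational_borel_mul hc hc1 hg₀ hγ₀ hab ν h𝓕 μY f)
      (measurable_singularDefect hc γ₀ ν 𝓕 μY hfc) hT
      (fun Ω' hΩ' _ g₀ _ => setIntegral_singularDefect_unipotent_mul_eq_zero hc hc1 hg₀ hγ₀ hab ha hb ν h𝓕 μY hfc hf hΩ' g₀)
      hEint
  -- (5) conclusion
  have hk' : ∀ x : (quasiSplit F E c 3).automorphicQuotient,
      (quasiSplit F E c 3).quotFun (truncatedKernelClass ν 𝓕 T (fun γ : (quasiSplit F E c 3).arithmeticSubgroup => (((adelicVal F E c 3 _ (γ : (quasiSplit F E c 3).Adelic) :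
          GL (Fin 3) (AdeleRing (𝓞 E) E)) : Matrix (Fin 3) (Fin 3) (AdeleRing (𝓞 E) E)).charpoly,
        decide (∃ δ : (quasiSplit F E c 3).arithmeticSubgroup, δ * γ * δ⁻¹ ∈ arithmeticBorel F E c 3))) ((Polynomial.map (algebraMap E (AdeleRing (𝓞 E) E)) ((X - C (a : E)) ^ 2 * (X - C (b : E)))), true) f) x =
        ((∑' q : Quotient (QuotientGroup.rightRel (arithmeticBorel F E c 3 ⊓ Subgroup.centralizer ({γ₀} : Set (quasiSplit F E c 3).arithmeticSubgroup))), (fun y : (quasiSplit F E c 3).Adelic => (∑' n : {n : ↥((adelicUnipotent F E c 3).subgroupOf (quasiSplit F E c 3).arithmeticSubgroup ⊓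
        Subgroup.centralizer ({γ₀} : Set (quasiSplit F E c 3).arithmeticSubgroup)) // n ≠ 1},
      f (y⁻¹ * (((n.1 : (quasiSplit F E c 3).arithmeticSubgroup) * γ₀ : (quasiSplit F E c 3).arithmeticSubgroup) : (quasiSplit F E c 3).Adelic) * y)) -
      Set.indicator {y : (quasiSplit F E c 3).Adelic | T < borelHeight y}
        (fun y : (quasiSplit F E c 3).Adelic => (μY (traceZeroFundamentalDomain F E c)).toReal⁻¹ • ∫ w : traceZeroAdele F E c, f (y⁻¹ * ((γ₀ : (quasiSplit F E c 3).Adelic) * (((heisElt hc 0 w : unipotentInBorel F E c 3) : borelAdelic F E c 3) : (quasiSplit F E c 3).Adelic)) * y) ∂μY) y) (((q.out : (quasiSplit F E c 3).arithmeticSubgroup) : (quasiSplit F E c 3).Adelic) * (Quotient.out x : (quasiSplit F E c 3).Adelic)⁻¹)) +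
          (quasiSplit F E c 3).quotFun (fun y : (quasiSplit F E c 3).Adelic => ∑' s : ↥(conjOrbit (quasiSplit F E c 3).arithmeticSubgroup (γ₀ : (quasiSplit F E c 3).Adelic)), f (y⁻¹ * (s : (quasiSplit F E c 3).Adelic) * y)) x) -
        (quasiSplit F E c 3).quotFun (pseudoEisenstein ({y : (quasiSplit F E c 3).Adelic | T < borelHeight y}.indicator (fun z : (quasiSplit F E c 3).Adelic => kernelBorelClass ν 𝓕 (fun γ : (quasiSplit F E c 3).arithmeticSubgroup => (((adelicVal F E c 3 _ (γ : (quasiSplit F E c 3).Adelic) :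
          GL (Fin 3) (AdeleRing (𝓞 E) E)) : Matrix (Fin 3) (Fin 3) (AdeleRing (𝓞 E) E)).charpoly,
        decide (∃ δ : (quasiSplit F E c 3).arithmeticSubgroup, δ * γ * δ⁻¹ ∈ arithmeticBorel F E c 3)))
      ((Polynomial.map (algebraMap E (AdeleRing (𝓞 E) E)) ((X - C (a : E)) ^ 2 * (X - C (b : E)))), true) f z z -
        ∑' ξ : E, (μY (traceZeroFundamentalDomain F E c)).toReal⁻¹ • ∫ w : traceZeroAdele F E c, f (((((heisElt hc (algebraMap E (AdeleRing (𝓞 E) E) ξ) 0 : unipotentInBorel F E c 3) : borelAdelic F E c 3) : (quasiSplit F E c 3).Adelic) * z)⁻¹ * ((γ₀ : (quasiSplit F E c 3).Adelic) * (((heisElt hc 0 w : unipotentInBorel F E c 3) : borelAdelic F E c 3) : (quasiSplit F E c 3).Adelic)) * ((((heisElt hc (algebraMap E (AdeleRing (𝓞 E) E) ξ) 0 : unipotentInBorel F E c 3) : borelAdelic F E c 3) : (quasiSplit F E c 3).Adelic) * z)) ∂μY))) x := fun x => by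
    rw [hpt x]; ring
  have h1 : ∫ x, ((∑' q : Quotient (QuotientGroup.rightRel (arithmeticBorel F E c 3 ⊓ Subgroup.centralizer ({γ₀} : Set (quasiSplit F E c 3).arithmeticSubgroup))), (fun y : (quasiSplit F E c 3).Adelic => (∑' n : {n : ↥((adelicUnipotent F E c 3).subgroupOf (quasiSplit F E c 3).arithmeticSubgroup ⊓
        Subgroup.centralizer ({γ₀} : Set (quasiSplit F E c 3).arithmeticSubgroup)) // n ≠ 1},
      f (y⁻¹ * (((n.1 : (quasiSplit F E c 3).arithmeticSubgroup) * γ₀ : (quasiSplit F E c 3).arithmeticSubgroup) : (quasiSplit F E c 3).Adelic) * y)) -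
      Set.indicator {y : (quasiSplit F E c 3).Adelic | T < borelHeight y}
        (fun y : (quasiSplit F E c 3).Adelic => (μY (traceZeroFundamentalDomain F E c)).toReal⁻¹ • ∫ w : traceZeroAdele F E c, f (y⁻¹ * ((γ₀ : (quasiSplit F E c 3).Adelic) * (((heisElt hc 0 w : unipotentInBorel F E c 3) : borelAdelic F E c 3) : (quasiSplit F E c 3).Adelic)) * y) ∂μY) y) (((q.out : (quasiSplit F E c 3).arithmeticSubgroup) : (quasiSplit F E c 3).Adelic) * (Quotient.out x : (quasiSplit F E c 3).Adelic)⁻¹)) + (quasiSplit F E c 3).quotFun (fun y : (quasiSplit F E c 3).Adelic => ∑' s : ↥(conjOrbit (quasiSplit F E c 3).arithmeticSubgroup (γ₀ : (quasiSplit F E c 3).Adelic)), f (y⁻¹ * (s : (quasiSplit F E c 3).Adelic) * y)) x) - (quasiSplit F E c 3).quotFun (pseudoEisenstein ({y : (quasiSplit F E c 3).Adelic | T < borelHeight y}.indicator (fun z : (quasiSplit F E c 3).Adelic => kernelBorelClass ν 𝓕 (fun γ : (quasiSplit F E c 3).arithmeticSubgroup => (((adelicVal F E c 3 _ (γ : (quasiSplit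 F E c 3).Adelic) :
          GL (Fin 3) (AdeleRing (𝓞 E) E)) : Matrix (Fin 3) (Fin 3) (AdeleRing (𝓞 E) E)).charpoly,
        decide (∃ δ : (quasiSplit F E c 3).arithmeticSubgroup, δ * γ * δ⁻¹ ∈ arithmeticBorel F E c 3)))
      ((Polynomial.map (algebraMap E (AdeleRing (𝓞 E) E)) ((X - C (a : E)) ^ 2 * (X - C (b : E)))), true) f z z -
        ∑' ξ : E, (μY (traceZeroFundamentalDomain F E c)).toReal⁻¹ • ∫ w : traceZeroAdele F E c, f (((((heisElt hc (algebraMap E (AdeleRing (𝓞 E) E) ξ) 0 : unipotentInBorel F E c 3) : borelAdelic F E c 3) : (quasiSplit F E c 3).Adelic) * z)⁻¹ * ((γ₀ : (quasiSplit F E c 3).Adelic) * (((heisElt hc 0 w : unipotentInBorel F E c 3) : borelAdelic F E c 3) : (quasiSplit F E c 3).Adelic)) * ((((heisElt hc (algebraMap E (AdeleRing (𝓞 E) E) ξ) 0 : unipotentInBorel F E c 3) : borelAdelic F E c 3) : (quasiSplit F E c 3).Adelic) * z)) ∂μY))) x ∂μ =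
      (∫ x, ((∑' q : Quotient (QuotientGroup.rightRel (arithmeticBorel F E c 3 ⊓ Subgroup.centralizer ({γ₀} : Set (quasiSplit F E c 3).arithmeticSubgroup))), (fun y : (quasiSplit F E c 3).Adelic => (∑' n : {n : ↥((adelicUnipotent F E c 3).subgroupOf (quasiSplit F E c 3).arithmeticSubgroup ⊓
        Subgroup.centralizer ({γ₀} : Set (quasiSplit F E c 3).arithmeticSubgroup)) // n ≠ 1},
      f (y⁻¹ * (((n.1 : (quasiSplit F E c 3).arithmeticSubgroup) * γ₀ : (quasiSplit F E c 3).arithmeticSubgroup) : (quasiSplit F E c 3).Adelic) * y)) -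
      Set.indicator {y : (quasiSplit F E c 3).Adelic | T < borelHeight y}
        (fun y : (quasiSplit F E c 3).Adelic => (μY (traceZeroFundamentalDomain F E c)).toReal⁻¹ • ∫ w : traceZeroAdele F E c, f (y⁻¹ * ((γ₀ : (quasiSplit F E c 3).Adelic) * (((heisElt hc 0 w : unipotentInBorel F E c 3) : borelAdelic F E c 3) : (quasiSplit F E c 3).Adelic)) * y) ∂μY) y) (((q.out : (quasiSplit F E c 3).arithmeticSubgroup) : (quasiSplit F E c 3).Adelic) * (Quotient.out x : (quasiSplit F E c 3).Adelic)⁻¹)) + (quasiSplit F E c 3).quotFun (fun y : (quasiSplit F E c 3).Adelic => ∑' s : ↥(conjOrbit (quasiSplit F E c 3).arithmeticSubgroup (γ₀ : (quasiSplit F E c 3).Adelic)), f (y⁻¹ * (s : (quasiSplit F E c 3).Adelic) * y)) x) ∂μ) - ∫ x, (quasiSplit F E c 3).quotFun (pseudoEisenstein ({y : (quasiSplit F E c 3).Adelic | T < borelHeight y}.indicator (fun z : (quasiSplit F E c 3).Adelic => kernelBorelClass ν 𝓕 (fun γ : (quasiSplit F E c 3).arithmeticSubgroup => (((adelicVal F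 E c 3 _ (γ : (quasiSplit F E c 3).Adelic) :
          GL (Fin 3) (AdeleRing (𝓞 E) E)) : Matrix (Fin 3) (Fin 3) (AdeleRing (𝓞 E) E)).charpoly,
        decide (∃ δ : (quasiSplit F E c 3).arithmeticSubgroup, δ * γ * δ⁻¹ ∈ arithmeticBorel F E c 3)))
      ((Polynomial.map (algebraMap E (AdeleRing (𝓞 E) E)) ((X - C (a : E)) ^ 2 * (X - C (b : E)))), true) f z z -
        ∑' ξ : E, (μY (traceZeroFundamentalDomain F E c)).toReal⁻¹ • ∫ w : traceZeroAdele F E c, f (((((heisElt hc (algebraMap E (AdeleRing (𝓞 E) E) ξ) 0 : unipotentInBorel F E c 3) : borelAdelic F E c 3) : (quasiSplit F E c 3).Adelic) * z)⁻¹ * ((γ₀ : (quasiSplit F E c 3).Adelic) * (((heisElt hc 0 w : unipotentInBorel F E c 3) : borelAdelic F E c 3) : (quasiSplit F E c 3).Adelic)) * ((((heisElt hc (algebraMap E (AdeleRing (𝓞 E) E) ξ) 0 : unipotentInBorel F E c 3) : borelAdelic F E c 3) : (quasiSplit F E c 3).Adelic) * z)) ∂μY))) x ∂μ :=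
    integral_sub (hInt.add hS) hEint
  have h2 : ∫ x, ((∑' q : Quotient (QuotientGroup.rightRel (arithmeticBorel F E c 3 ⊓ Subgroup.centralizer ({γ₀} : Set (quasiSplit F E c 3).arithmeticSubgroup))), (fun y : (quasiSplit F E c 3).Adelic => (∑' n : {n : ↥((adelicUnipotent F E c 3).subgroupOf (quasiSplit F E c 3).arithmeticSubgroup ⊓
        Subgroup.centralizer ({γ₀} : Set (quasiSplit F E c 3).arithmeticSubgroup)) // n ≠ 1},
      f (y⁻¹ * (((n.1 : (quasiSplit F E c 3).arithmeticSubgroup) * γ₀ : (quasiSplit F E c 3).arithmeticSubgroup) : (quasiSplit F E c 3).Adelic) * y)) -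
      Set.indicator {y : (quasiSplit F E c 3).Adelic | T < borelHeight y}
        (fun y : (quasiSplit F E c 3).Adelic => (μY (traceZeroFundamentalDomain F E c)).toReal⁻¹ • ∫ w : traceZeroAdele F E c, f (y⁻¹ * ((γ₀ : (quasiSplit F E c 3).Adelic) * (((heisElt hc 0 w : unipotentInBorel F E c 3) : borelAdelic F E c 3) : (quasiSplit F E c 3).Adelic)) * y) ∂μY) y) (((q.out : (quasiSplit F E c 3).arithmeticSubgroup) : (quasiSplit F E c 3).Adelic) * (Quotient.out x : (quasiSplit F E c 3).Adelic)⁻¹)) + (quasiSplit F E c 3).quotFun (fun y : (quasiSplit F E c 3).Adelic => ∑' s : ↥(conjOrbit (quasiSplit F E c 3).arithmeticSubgroup (γ₀ : (quasiSplit F E c 3).Adelic)), f (y⁻¹ * (s : (quasiSplit F E c 3).Adelic) * y)) x) ∂μ =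
      (∫ x, (∑' q : Quotient (QuotientGroup.rightRel (arithmeticBorel F E c 3 ⊓ Subgroup.centralizer ({γ₀} : Set (quasiSplit F E c 3).arithmeticSubgroup))), (fun y : (quasiSplit F E c 3).Adelic => (∑' n : {n : ↥((adelicUnipotent F E c 3).subgroupOf (quasiSplit F E c 3).arithmeticSubgroup ⊓
        Subgroup.centralizer ({γ₀} : Set (quasiSplit F E c 3).arithmeticSubgroup)) // n ≠ 1},
      f (y⁻¹ * (((n.1 : (quasiSplit F E c 3).arithmeticSubgroup) * γ₀ : (quasiSplit F E c 3).arithmeticSubgroup) : (quasiSplit F E c 3).Adelic) * y)) -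
      Set.indicator {y : (quasiSplit F E c 3).Adelic | T < borelHeight y}
        (fun y : (quasiSplit F E c 3).Adelic => (μY (traceZeroFundamentalDomain F E c)).toReal⁻¹ • ∫ w : traceZeroAdele F E c, f (y⁻¹ * ((γ₀ : (quasiSplit F E c 3).Adelic) * (((heisElt hc 0 w : unipotentInBorel F E c 3) : borelAdelic F E c 3) : (quasiSplit F E c 3).Adelic)) * y) ∂μY) y) (((q.out : (quasiSplit F E c 3).arithmeticSubgroup) : (quasiSplit F E c 3).Adelic) * (Quotient.out x : (quasiSplit F E c 3).Adelic)⁻¹)) ∂μ) + ∫ x, (quasiSplit F E c 3).quotFun (fun y : (quasiSplit F E c 3).Adelic => ∑' s : ↥(conjOrbit (quasiSplit F E c 3).arithmeticSubgroup (γ₀ : (quasiSplit F E c 3).Adelic)), f (y⁻¹ * (s : (quasiSplit F E c 3).Adelic) * y)) x ∂μ :=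
    integral_add hInt hS
  rw [truncatedTraceClass_def, integral_congr_ae (Filter.Eventually.of_forall hk'), h1, h2, hE0, hUnf]
  ring

end Assembly

/-! ## §9 The CM closer: every hypothesis but the integrability of the semisimple summand discharged -/

section CM

/-- **ROGAWSKI'S PROP. 7.2.1 ⇒ (7.2.3) FOR THE QUASI-SPLIT `U(J₃)` OF A CM FIELD.**  At the CM pair `(L⁺, L, complexConj)`:
unimodularity (★ `forall_isHaarMeasure_isMulRightInvariant_quasiSplit_cm_three`), Iwasawa (★
`exists_mem_borelAdelic_mul_mem_standardMaximalCompactGL_cm_three`), the integrability of `k^T_{i♭}` for `T ≫ 1` (★ (W2-b) FILE 1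
`integrable_quotFun_pseudoEisenstein_indicator_cm`) and the absolute integrability of the bracket (★ (b2-β)
`lintegral_weight_mul_enorm_singularBracket_lt_top`, [L : L⁺] = 2) are in the tree, so for a TEST function `f`, every covering
weight `β` of `B_{γ₀}(F)♯` and every Haar measure `ν_G`: there is `T₀` with, for all `T > T₀`,

  `J^T_{i♭}(f) = ∫_X Σ'_{s ∈ [γ₀]} f(x̃ s x̃⁻¹) dμ(x) + c_μ · ∫_{G(𝔸)} (β g) • b_T(g) dν_G(g)`,

granted only the `μ`-integrability of the semisimple summand (★ (b1) `integral_conjTsum_conjOrbit_singular_eq_covol_mul_cm`, in the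
`conjTsum` spelling). [cite: Rogawski1990, §7.2 Prop. 7.2.1, (7.2.3) (pp. 91–93)] [cite: Arthur1978TraceFormulaI, §8] -/
theorem truncatedTraceClass_singular_eq_integral_add_mul_integral_singularBracket_cm (L : Type) [Field L] [NumberField L]
    [IsCMField L]
    [MeasurableSpace (AdeleRing (𝓞 L) L)] [BorelSpace (AdeleRing (𝓞 L) L)]
    [MeasurableSpace (adelicUnipotent (↥(maximalRealSubfield L)) L (IsCMField.complexConj L) 3)] [BorelSpace (adelicUnipotent (↥(maximalRealSubfield L)) L (IsCMField.complexConj L) 3)]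
    [MeasurableSpace (quasiSplit (↥(maximalRealSubfield L)) L (IsCMField.complexConj L) 3).Adelic] [BorelSpace (quasiSplit (↥(maximalRealSubfield L)) L (IsCMField.complexConj L) 3).Adelic]
    (hc : IsCMField.complexConj L * IsCMField.complexConj L = 1)
    {a b : Lˣ} {g₀ : (quasiSplit (↥(maximalRealSubfield L)) L (IsCMField.complexConj L) 3).Rational} {γ₀ : (quasiSplit (↥(maximalRealSubfield L)) L (IsCMField.complexConj L) 3).arithmeticSubgroup}
    (hg₀ : ((g₀.val : GL (Fin 3) L) : Matrix (Fin 3) (Fin 3) L) = !![(a : L), 0, 0; 0, b, 0; 0, 0, a])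
    (hγ₀ : (γ₀ : (quasiSplit (↥(maximalRealSubfield L)) L (IsCMField.complexConj L) 3).Adelic) = (quasiSplit (↥(maximalRealSubfield L)) L (IsCMField.complexConj L) 3).toAdelic g₀)
    (hab : (a : L) ≠ (b : L)) (ha : (IsCMField.complexConj L) (a : L) * (a : L) = 1)
    (hb : (IsCMField.complexConj L) (b : L) * (b : L) = 1)
    (ν : Measure (adelicUnipotent (↥(maximalRealSubfield L)) L (IsCMField.complexConj L) 3)) [ν.IsHaarMeasure]
    {𝓕 : Set (adelicUnipotent (↥(maximalRealSubfield L)) L (IsCMField.complexConj L) 3)} (h𝓕 : IsFundamentalDomain (rationalUnipotent (↥(maximalRealSubfield L)) L (IsCMField.complexConj L) 3) 𝓕 ν)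
    (μ : Measure (quasiSplit (↥(maximalRealSubfield L)) L (IsCMField.complexConj L) 3).automorphicQuotient) [(quasiSplit (↥(maximalRealSubfield L)) L (IsCMField.complexConj L) 3).IsAutomorphicMeasure μ]
    (νG : Measure (quasiSplit (↥(maximalRealSubfield L)) L (IsCMField.complexConj L) 3).Adelic) [νG.IsHaarMeasure]
    (μY : Measure (traceZeroAdele (↥(maximalRealSubfield L)) L (IsCMField.complexConj L))) [μY.IsAddHaarMeasure] [μY.Regular]
    {f : (quasiSplit (↥(maximalRealSubfield L)) L (IsCMField.complexConj L) 3).Adelic → ℂ} (hf : IsQuasiSplitTest (↥(maximalRealSubfield L)) L (IsCMField.complexConj L) 3 f)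
    {β : (quasiSplit (↥(maximalRealSubfield L)) L (IsCMField.complexConj L) 3).Adelic → ℝ≥0∞}
    (hβ : IsCoveringWeight ((arithmeticBorel (↥(maximalRealSubfield L)) L (IsCMField.complexConj L) 3 ⊓ Subgroup.centralizer ({γ₀} : Set (quasiSplit (↥(maximalRealSubfield L)) L (IsCMField.complexConj L) 3).arithmeticSubgroup)).map (quasiSplit (↥(maximalRealSubfield L)) L (IsCMField.complexConj L) 3).arithmeticSubgroup.subtype) β)
    (hS : Integrable ((quasiSplit (↥(maximalRealSubfield L)) L (IsCMField.complexConj L) 3).quotFun (fun y : (quasiSplit (↥(maximalRealSubfield L)) L (IsCMField.complexConj L) 3).Adelic => ∑' s : ↥(conjOrbit (quasiSplit (↥(maximalRealSubfield L)) L (IsCMField.complexConj L) 3).arithmeticSubgroup (γ₀ : (quasiSplit (↥(maximalRealSubfield L)) L (IsCMField.complexConj L) 3).Adelic)), f (y⁻¹ * (s : (quasiSplit (↥(maximalRealSubfield L)) L (IsCMField.complexConj L) 3).Adelic) * y))) μ) :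
    haveI := t2Space_adeleRing_of_numberField L
    haveI := locallyCompactSpace_adeleRing' L
    haveI := secondCountableTopology_adeleRing L
    haveI : T2Space (quasiSplit (↥(maximalRealSubfield L)) L (IsCMField.complexConj L) 3).Adelic :=
      inferInstanceAs (T2Space (adelic (↥(maximalRealSubfield L)) L (IsCMField.complexConj L) 3 ((StdForm.antidiagonal 3).over L)))
    haveI : LocallyCompactSpace (quasiSplit (↥(maximalRealSubfield L)) L (IsCMField.complexConj L) 3).Adelic :=
      inferInstanceAs (LocallyCompactSpace (adelic (↥(maximalRealSubfield L)) L (IsCMField.complexConj L) 3 ((StdForm.antidiagonal 3).over L)))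
    haveI : SecondCountableTopology (quasiSplit (↥(maximalRealSubfield L)) L (IsCMField.complexConj L) 3).Adelic :=
      inferInstanceAs (SecondCountableTopology (adelic (↥(maximalRealSubfield L)) L (IsCMField.complexConj L) 3 ((StdForm.antidiagonal 3).over L)))
    haveI : DiscreteTopology (quasiSplit (↥(maximalRealSubfield L)) L (IsCMField.complexConj L) 3).quotientSubgroup := by
      rw [quotientSubgroup_quasiSplit]; exact isDiscreteRational_quasiSplit
    letI := AdelicGroupData.measurableSpaceQuotientForm (quasiSplit (↥(maximalRealSubfield L)) L (IsCMField.complexConj L) 3)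
    haveI := AdelicGroupData.borelSpaceQuotientForm (quasiSplit (↥(maximalRealSubfield L)) L (IsCMField.complexConj L) 3)
    haveI := AdelicGroupData.smulInvariantMeasureQuotientForm (quasiSplit (↥(maximalRealSubfield L)) L (IsCMField.complexConj L) 3) μ
    haveI := AdelicGroupData.isFiniteMeasureOnCompactsQuotientForm (quasiSplit (↥(maximalRealSubfield L)) L (IsCMField.complexConj L) 3) μ
    ∃ T₀ : ℝ≥0, ∀ T : ℝ≥0, T₀ < T →
      truncatedTraceClass μ ν 𝓕 T (fun γ : (quasiSplit (↥(maximalRealSubfield L)) L (IsCMField.complexConj L) 3).arithmeticSubgroup => (((adelicVal (↥(maximalRealSubfield L)) L (IsCMField.complexConj L) 3 _ (γ : (quasiSplit (↥(maximalRealSubfield L)) L (IsCMField.complexConj L) 3).Adelic) :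
          GL (Fin 3) (AdeleRing (𝓞 L) L)) : Matrix (Fin 3) (Fin 3) (AdeleRing (𝓞 L) L)).charpoly,
        decide (∃ δ : (quasiSplit (↥(maximalRealSubfield L)) L (IsCMField.complexConj L) 3).arithmeticSubgroup, δ * γ * δ⁻¹ ∈ arithmeticBorel (↥(maximalRealSubfield L)) L (IsCMField.complexConj L) 3))) ((Polynomial.map (algebraMap L (AdeleRing (𝓞 L) L)) ((X - C (a : L)) ^ 2 * (X - C (b : L)))), true) f =
        (∫ x, (quasiSplit (↥(maximalRealSubfield L)) L (IsCMField.complexConj L) 3).quotFun (fun y : (quasiSplit (↥(maximalRealSubfield L)) L (IsCMField.complexConj L) 3).Adelic => ∑' s : ↥(conjOrbit (quasiSplit (↥(maximalRealSubfield L)) L (IsCMField.complexConj L) 3).arithmeticSubgroup (γ₀ : (quasiSplit (↥(maximalRealSubfield L)) L (IsCMField.complexConj L) 3).Adelic)), f (y⁻¹ * (s : (quasiSplit (↥(maximalRealSubfield L)) L (IsCMField.complexConj L) 3).Adelic) * y)) x ∂μ) +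
          ((unfoldingConstant (quasiSplit (↥(maximalRealSubfield L)) L (IsCMField.complexConj L) 3).quotientSubgroup
              (count : Measure (quasiSplit (↥(maximalRealSubfield L)) L (IsCMField.complexConj L) 3).quotientSubgroup) μ νG : ℝ) : ℂ) *
            ∫ g, (β g).toReal • (fun y : (quasiSplit (↥(maximalRealSubfield L)) L (IsCMField.complexConj L) 3).Adelic => (∑' n : {n : ↥((adelicUnipotent (↥(maximalRealSubfield L)) L (IsCMField.complexConj L) 3).subgroupOf (quasiSplit (↥(maximalRealSubfield L)) L (IsCMField.complexConj L) 3).arithmeticSubgroup ⊓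
        Subgroup.centralizer ({γ₀} : Set (quasiSplit (↥(maximalRealSubfield L)) L (IsCMField.complexConj L) 3).arithmeticSubgroup)) // n ≠ 1},
      f (y⁻¹ * (((n.1 : (quasiSplit (↥(maximalRealSubfield L)) L (IsCMField.complexConj L) 3).arithmeticSubgroup) * γ₀ : (quasiSplit (↥(maximalRealSubfield L)) L (IsCMField.complexConj L) 3).arithmeticSubgroup) : (quasiSplit (↥(maximalRealSubfield L)) L (IsCMField.complexConj L) 3).Adelic) * y)) -
      Set.indicator {y : (quasiSplit (↥(maximalRealSubfield L)) L (IsCMField.complexConj L) 3).Adelic | T < borelHeight y}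
        (fun y : (quasiSplit (↥(maximalRealSubfield L)) L (IsCMField.complexConj L) 3).Adelic => (μY (traceZeroFundamentalDomain (↥(maximalRealSubfield L)) L (IsCMField.complexConj L))).toReal⁻¹ • ∫ w : traceZeroAdele (↥(maximalRealSubfield L)) L (IsCMField.complexConj L), f (y⁻¹ * ((γ₀ : (quasiSplit (↥(maximalRealSubfield L)) L (IsCMField.complexConj L) 3).Adelic) * (((heisElt hc 0 w : unipotentInBorel (↥(maximalRealSubfield L)) L (IsCMField.complexConj L) 3) : borelAdelic (↥(maximalRealSubfield L)) L (IsCMField.complexConj L) 3) : (quasiSplit (↥(maximalRealSubfield L)) L (IsCMField.complexConj L) 3).Adelic)) * y) ∂μY) y) g ∂νG := by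
  haveI := t2Space_adeleRing_of_numberField L
  haveI := locallyCompactSpace_adeleRing' L
  haveI := secondCountableTopology_adeleRing L
  haveI : T2Space (quasiSplit (↥(maximalRealSubfield L)) L (IsCMField.complexConj L) 3).Adelic :=
    inferInstanceAs (T2Space (adelic (↥(maximalRealSubfield L)) L (IsCMField.complexConj L) 3 ((StdForm.antidiagonal 3).over L)))
  haveI : LocallyCompactSpace (quasiSplit (↥(maximalRealSubfield L)) L (IsCMField.complexConj L) 3).Adelic :=
    inferInstanceAs (LocallyCompactSpace (adelic (↥(maximalRealSubfield L)) L (IsCMField.complexConj L) 3 ((StdForm.antidiagonal 3).over L)))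
  haveI : SecondCountableTopology (quasiSplit (↥(maximalRealSubfield L)) L (IsCMField.complexConj L) 3).Adelic :=
    inferInstanceAs (SecondCountableTopology (adelic (↥(maximalRealSubfield L)) L (IsCMField.complexConj L) 3 ((StdForm.antidiagonal 3).over L)))
  haveI : DiscreteTopology (quasiSplit (↥(maximalRealSubfield L)) L (IsCMField.complexConj L) 3).quotientSubgroup := by
    rw [quotientSubgroup_quasiSplit]; exact isDiscreteRational_quasiSplit
  letI := AdelicGroupData.measurableSpaceQuotientForm (quasiSplit (↥(maximalRealSubfield L)) L (IsCMField.complexConj L) 3)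
  haveI := AdelicGroupData.borelSpaceQuotientForm (quasiSplit (↥(maximalRealSubfield L)) L (IsCMField.complexConj L) 3)
  haveI := AdelicGroupData.smulInvariantMeasureQuotientForm (quasiSplit (↥(maximalRealSubfield L)) L (IsCMField.complexConj L) 3) μ
  haveI := AdelicGroupData.isFiniteMeasureOnCompactsQuotientForm (quasiSplit (↥(maximalRealSubfield L)) L (IsCMField.complexConj L) 3) μ
  have hc1 : IsCMField.complexConj L ≠ 1 := IsCMField.complexConj_ne_one L
  have h2 : Module.finrank (↥(maximalRealSubfield L)) L = 2 :=
    Algebra.IsQuadraticExtension.finrank_eq_two (↥(maximalRealSubfield L)) L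
  have hunimod := forall_isHaarMeasure_isMulRightInvariant_quasiSplit_cm_three L
  have hBK := exists_mem_borelAdelic_mul_mem_standardMaximalCompactGL_cm_three L
  haveI : νG.IsMulRightInvariant := hunimod νG inferInstance
  haveI : νG.IsInvInvariant := isInvInvariant_of_isMulRightInvariant νG
  have hcl := isConjInvariant_borelRefine (isConjInvariant_charpoly_adelicVal (F := (↥(maximalRealSubfield L))) (E := L) (c := (IsCMField.complexConj L)) (N := 3))
  have hclN := isUnipotentInvariantOnBorel_borelRefine
    (isUnipotentInvariantOnBorel_charpoly_adelicVal (F := (↥(maximalRealSubfield L))) (E := L) (c := (IsCMField.complexConj L)) (N := 3))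
  -- (i) integrability of `k^T_{i♭}` for `T > T₁ ≥ 1`
  obtain ⟨T₁, hT₁, -, hkT⟩ := integrable_quotFun_pseudoEisenstein_indicator_cm L hcl hclN ν 𝓕 h𝓕 μ f hf ((Polynomial.map (algebraMap L (AdeleRing (𝓞 L) L)) ((X - C (a : L)) ^ 2 * (X - C (b : L)))), true)
  refine ⟨T₁, fun T hT => ?_⟩
  have hT1 : 1 ≤ T := hT₁.trans hT.le
  have hT0 : 0 < T := lt_of_lt_of_le one_pos hT1
  -- (b2-β): auxiliary Haar measures
  haveI : LocallyCompactSpace (borelAdelic (↥(maximalRealSubfield L)) L (IsCMField.complexConj L) 3) := locallyCompactSpace_borelAdelic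
  haveI : SecondCountableTopology (borelAdelic (↥(maximalRealSubfield L)) L (IsCMField.complexConj L) 3) :=
    secondCountableTopology_borelAdelic
  haveI : T2Space (borelAdelic (↥(maximalRealSubfield L)) L (IsCMField.complexConj L) 3) := t2Space_borelAdelic
  haveI : LocallyCompactSpace (torusInBorel (↥(maximalRealSubfield L)) L (IsCMField.complexConj L) 3) :=
    (isTopSemidirect_borelAdelic (F := (↥(maximalRealSubfield L))) (E := L) (c := (IsCMField.complexConj L)) (N := 3)).isClosed_left.locallyCompactSpace
  haveI : SecondCountableTopology (torusInBorel (↥(maximalRealSubfield L)) L (IsCMField.complexConj L) 3) := TopologicalSpace.Subtype.secondCountableTopology _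
  haveI : CompactSpace ((standardMaximalCompactGL 3 L).comap
      (adelicVal (↥(maximalRealSubfield L)) L (IsCMField.complexConj L) 3 ((StdForm.antidiagonal 3).over L)) : Subgroup (quasiSplit (↥(maximalRealSubfield L)) L (IsCMField.complexConj L) 3).Adelic) :=
    isCompact_iff_compactSpace.1 isCompact_comap_adelicVal_standardMaximalCompactGL
  haveI := locallyCompactSpace_traceZeroAdele (F := (↥(maximalRealSubfield L))) (E := L) (c := (IsCMField.complexConj L))
  haveI : SecondCountableTopology (traceZeroAdele (↥(maximalRealSubfield L)) L (IsCMField.complexConj L)) := TopologicalSpace.Subtype.secondCountableTopology _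
  haveI : SigmaFinite μY := MeasureTheory.Measure.IsAddHaarMeasure.sigmaFinite μY
  obtain ⟨K₀⟩ := (inferInstance : Nonempty (TopologicalSpace.PositiveCompacts (AdeleRing (𝓞 L) L)))
  set μX : Measure (AdeleRing (𝓞 L) L) := Measure.addHaarMeasure K₀ with hμX
  set μB : Measure (borelAdelic (↥(maximalRealSubfield L)) L (IsCMField.complexConj L) 3) := Measure.haar with hμB
  set μT : Measure (torusInBorel (↥(maximalRealSubfield L)) L (IsCMField.complexConj L) 3) := Measure.haar with hμT
  haveI : SigmaFinite μT := MeasureTheory.Measure.IsHaarMeasure.sigmaFinite μT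
  set μK : Measure ((standardMaximalCompactGL 3 L).comap
      (adelicVal (↥(maximalRealSubfield L)) L (IsCMField.complexConj L) 3 ((StdForm.antidiagonal 3).over L)) : Subgroup (quasiSplit (↥(maximalRealSubfield L)) L (IsCMField.complexConj L) 3).Adelic) := Measure.haar with hμK
  have hbint := lintegral_weight_mul_enorm_singularBracket_lt_top hc hc1 h2 hab hg₀ hγ₀ hf hBK νG μB μT μK μX μY hβ hT0
  exact truncatedTraceClass_singular_eq_integral_add_mul_integral_singularBracket hc hc1 hunimod hBK hg₀ hγ₀ hab ha hb ν h𝓕 μ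
    νG μY hf.continuous' hf.hasCompactSupport' hβ hT1 (hkT T hT).1 hS hbint

end CM

/-! ## §10 The semisimple summand: `conjTsum` of ★ (b1) IS `quotFun` of the conjugacy-class series -/

section SemisimpleBridge

/-- **`conjTsum G(F) [γ₀] f = quotFun (y ↦ Σ'_{s ∈ [γ₀]} f(y⁻¹ s y))`** (definitional bookkeeping): the semisimple summand of
`truncatedTraceClass_singular_eq_integral_add_mul_integral_singularBracket` in the `conjTsum` letters of ★ (b1)
`integral_conjTsum_conjOrbit_singular_eq_covol_mul_cm`, whose first conjunct is then exactly the hypothesis `hS` of the CM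
closer and whose last conjunct evaluates `∫_X quotFun S dμ`. [cite: Gelbart1975, (9.12)] [cite: Rogawski1990, §7.2 Prop. 7.2.1 (p. 91)] -/
theorem conjTsum_conjOrbit_eq_quotFun (γ₀ : (quasiSplit F E c 3).arithmeticSubgroup) (f : (quasiSplit F E c 3).Adelic → ℂ) :
    conjTsum (quasiSplit F E c 3).quotientSubgroup (conjOrbit (quasiSplit F E c 3).arithmeticSubgroup (γ₀ : (quasiSplit F E c 3).Adelic))
        (conj_mem_conjOrbit_of_exists (quasiSplit F E c 3).arithmeticSubgroup (quasiSplit F E c 3).quotientSubgroup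
          (AdelicGroupData.exists_inv_mul_mem_centralizer_quotientSubgroup (quasiSplit F E c 3)) γ₀.2) f =
      (quasiSplit F E c 3).quotFun (fun y : (quasiSplit F E c 3).Adelic => ∑' s : ↥(conjOrbit (quasiSplit F E c 3).arithmeticSubgroup (γ₀ : (quasiSplit F E c 3).Adelic)), f (y⁻¹ * (s : (quasiSplit F E c 3).Adelic) * y)) := by
  funext x
  have hx : conjTsum (quasiSplit F E c 3).quotientSubgroup (conjOrbit (quasiSplit F E c 3).arithmeticSubgroup (γ₀ : (quasiSplit F E c 3).Adelic))
        (conj_mem_conjOrbit_of_exists (quasiSplit F E c 3).arithmeticSubgroup (quasiSplit F E c 3).quotientSubgroup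
          (AdelicGroupData.exists_inv_mul_mem_centralizer_quotientSubgroup (quasiSplit F E c 3)) γ₀.2) f x =
      conjTsum (quasiSplit F E c 3).quotientSubgroup (conjOrbit (quasiSplit F E c 3).arithmeticSubgroup (γ₀ : (quasiSplit F E c 3).Adelic))
        (conj_mem_conjOrbit_of_exists (quasiSplit F E c 3).arithmeticSubgroup (quasiSplit F E c 3).quotientSubgroup
          (AdelicGroupData.exists_inv_mul_mem_centralizer_quotientSubgroup (quasiSplit F E c 3)) γ₀.2) f
        (Quotient.mk _ (Quotient.out (x : (quasiSplit F E c 3).Adelic ⧸ (quasiSplit F E c 3).quotientSubgroup))) := by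
    rw [Quotient.out_eq]
  rw [hx]
  change (∑' s : ↥(conjOrbit (quasiSplit F E c 3).arithmeticSubgroup (γ₀ : (quasiSplit F E c 3).Adelic)),
      f (Quotient.out (x : (quasiSplit F E c 3).Adelic ⧸ (quasiSplit F E c 3).quotientSubgroup) * (s : (quasiSplit F E c 3).Adelic) *
        (Quotient.out (x : (quasiSplit F E c 3).Adelic ⧸ (quasiSplit F E c 3).quotientSubgroup))⁻¹)) =
    ∑' s : ↥(conjOrbit (quasiSplit F E c 3).arithmeticSubgroup (γ₀ : (quasiSplit F E c 3).Adelic)),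
      f ((Quotient.out (x : (quasiSplit F E c 3).Adelic ⧸ (quasiSplit F E c 3).quotientSubgroup))⁻¹⁻¹ * (s : (quasiSplit F E c 3).Adelic) *
        (Quotient.out (x : (quasiSplit F E c 3).Adelic ⧸ (quasiSplit F E c 3).quotientSubgroup))⁻¹)
  rw [inv_inv]

end SemisimpleBridge

end UnitaryGroup

end Literature.NumberTheory.Automorphic

end
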